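import Literature.MathematicalPhysics.QuantumFieldTheory.Balaban1983to89.B8Prop5JoinSectELocalRD

/-!
# `Balaban1983to89.B8Prop5JoinSectELocalRDW` — T. Bałaban, *Spaces of regular gauge field configurations on a lattice and gauge fixing conditions*,
# Commun. Math. Phys. **99** (1985) 75–102 [Balaban1985RegularSpaces] ("B8"), Sect. D–E pp. 92–97 with [Balaban1985Averaging] Prop. 10 p. 50:
# THE SECT. D∕E JOIN IN WITNESS FORM — Proposition 5's fixed point (local inversion route, [4]'s inverse laws on print's domains, the
# `…_RD` currency of record) FOR A GENERAL DATUM `u₁` READ THROUGH UNITARY `Λ_j`-WITNESSES, instead of Theorem 4's inductive `u₁ = glev_j`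

statement-level skeleton of published theorems with citation tags; proofs where landed; nothing here is a claim about the
Yang–Mills mass gap

PDF held: `paper:balaban1985-cmp99-regular-spaces-gauge-fixing` (journal page = PDF page + 74); pp. 88–89, 92–97.  [3] = [Balaban1985Averaging]
(Prop. 10 (203)–(204), (213)–(214) p. 50, (166)–(167) p. 44); [4] = [Balaban1985BackgroundPropagators] (Thm 3.1 p. 397, (3.24)–(3.25) p. 394).

## THE PRINTED TEXT

p. 94 [PDF 20]: «**Proposition 5.** There exist positive constants c₂, c₃, depending on d and L only, such that for an arbitrary configuration
U₁ satisfying (1.69), and for the configuration u₁ determined by U₁ and satisfying (1.68), (1.73), (1.74), if α₀ + α₁ ≦ c₂, then there exists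
a configuration u′ = e^{iλ} satisfying the equations (1.107) and the bounds (1.108).»  p. 89 [PDF 15]: «We will use only the properties (1.69),
(1.73), (1.74) of the configurations u₁, U₁ in the future. … (1.73), (1.74) together with the condition R₀\overline{u₁}ʲ = 1 on Λ_j imply that
u₁ satisfies (166), (167) [3] on Bʲ(Λ_j) ⊂ T_{L^{−j}}, thus … the assumptions of Proposition 10 are satisfied».

## WHY THIS FILE (cell `pub-ymgap`, HUMAN RULING D-0062; R134 seat `pub-ymgap-dag-n05-c` g3, DAG node N05 = [B8]; `pub-ymgap-dag-n05-d` g2's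
LOCATED-NEXT (L1); count-neutral)

The JOIN of record `B8Prop5JoinSectELocalRD.hFP_kLevel_of_sectE_local'_RD` (p466338; consumed by the `SockHFP` providers `B8SockHFPRD` and every
N05 knit) reaches the gauge transformation `u₁` ONLY through Theorem 4's inductive datum: (1.34) `InAx` + (1.29) `Restr129` give «`u₁ = glev_j` on
the towers» (`B8Eq1117KLevel.glev_on_towers_of_axial`), and the small gauge-fixed field `e^{B}U₀` ((1.69) `h69`, unitarity `hBu`, plaquette
regularity `hP`, [3] Props 8–9 windows `hsmall hc₃ hsc`) makes `glev_j` a UNITARY `Λ_j`-WITNESS (`B8SectEInLambdaWitness.witness_unitary_of_glev`,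
class constant `α₃ = 40d·c_B`).  Everything downstream is ALREADY typed against witnesses (`pub-ymgap-dag-n04-b`'s
`B8SectEKLevelInLambda.exists_Dprime_kLevel_w` ∕ `Dprime_lipschitz_kLevel_w`, `B8Restr129InversionLocal.restr129_mul_inv_of_cond179_local`,
`B8SectERemainderCovariance.Cnl_negStar_of_witness`).  Print's Proposition 5 takes a GENERAL `u₁` with (1.68), (1.73), (1.74) — which IS a family
of unitary `Λ_j`-witnesses (`B8Prop5WitnessOfDatum.hwit_unitary_of_datum`, this seat).  THIS FILE re-runs the three JOIN theorems of the RD file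
(and the Sect. E sub-assembly `B8Prop5JoinSectE.{sectE_exists, sectE_lipschitz, sectE_real, exists_Dprime_map}`, `B8Prop5JoinSectELocal.
restr129_mul_gaugeExp_local`) with the Theorem-4 datum binders `hBu h69 hP hAx hsmall hc₃ hsc` (and the implicit small field `B`, `αP`, `c_B`)
REPLACED by ONE binder — the unitary witnesses `hwit` at every `(j ≤ k, y ∈ Λ_j)` with a FREE class constant `α₃` — and (1.29) `Restr129 … u₁`
kept (print's (1.68)); every window that read `40d·c_B` now reads `α₃`; every other binder, constant and proof line VERBATIM.  The Theorem-4 JOIN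
of record is the instance `hwit := witness_unitary_of_glev ∘ glev_on_towers_of_axial`, `α₃ := 40d·c_B` (not restated here).

## WHAT THIS FILE PROVES (kernel, 0 sorry, theorems only; `𝔸` a nontrivial C⋆-algebra, unitary data)

* §1 `witness_inv_unitary_of_unitary` (a unitary witness for `u₁` gives a UNITARY witness `ũ⁻¹` for `u₁⁻¹`, same `α₃`; p05 `inLambda_inv`),
  `hwitinv_of_hwit` (the inverse-pair witnesses at every point of `𝔅_k`), `Cnl_negStar_inv_of_hwit` ([3]'s
  remainder covariance at `u₁⁻¹`, the binder `hCequiv`, from `Cnl_negStar_of_witness`).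
* §2 `sectE_exists_w`, `sectE_lipschitz_w`, `sectE_real_w`, `exists_Dprime_map_w` — Sect. E's `D′(u₁⁻¹, −i·)` on the ¼α₄-ball for the inverse
  pair, witness form (n04-b's `_w` cores BY NAME).
* §3 `restr129_mul_gaugeExp_local_w` ((1.29) for `u₁·e^{iλ′}` by the local inversion route), **`hFP_kLevel_of179_local_RD_w`** (JOIN-B).
* §4 **`hFP_kLevel_of_sectE_local_RD_w`** (JOIN-C), §5 **`hFP_kLevel_of_sectE_local'_RD_w`** (JOIN-C with `hCequiv` discharged) — the theorem a
  Proposition-5 provider AT A GENERAL DATUM instantiates (next module: `B8.Prop5Exists` at `B8Prop5LandauDataZd.zdLan`).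

## HONEST SCOPE

Assembly over landed modules; nothing of [4] (letters = HYPOTHESES with their laws), of [3] Prop. 10 beyond n04-b's∕r04's theorems, or of
Sect. E beyond n05-b's is proved here; `hHequiv` stays DISPLAYED.  Constants are the lineage's, sufficient only.  Count-neutral; N05 NOT
discharged; one finite `T⁴` programme at fixed `ε`; nothing continuum ∕ ℝ⁴ ∕ OS ∕ mass-gap ∕ Clay.  Unit `pub-ymgap-dag-n05-c` (g3), 2026-08-27.
Tree API by name only, nothing restated (the five private scalar lemmas of §0 are file-local copies of `B8Prop5JoinSectE`'s private ones, as in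
the RD file).
-/


noncomputable section

open NormedSpace Metric Set Filter Topology
open Complex (I)

namespace Literature.MathematicalPhysics.QuantumFieldTheory.Balaban1983to89.B8Prop5JoinSectELocalRDW

open B7Prop1Explicit (e U1 expUnit val_inv_expUnit)
open B7Prop2Explicit (unitaryUnits mem_unitaryUnits unitaryUnits_le_U1 avgClosed_unitaryUnits AvgClosed C0 c2')
open B7Prop1Local (InBox pdevOn)
open B7Prop3Flat (expCfg c3)
open B7Eq78Linearization (conjR zdBlocking QprimeIter QprimeIter_smul)
open B7Eq170Flat (cj cj_apply)
open B7Prop10General (C6 C4G)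
open B7Prop10Flat (one_le_C5 C4'_nonneg C5'_nonneg)
open B7Prop9Flat (C5')
open B7Eq214General (Cgen)
open B8Ineq130 (tlo thi)
open B7Eq92Concrete (mgauge)
open B8Eq119TwistedAxial (bgT Restr129)
open B8Eq178Averages (util178 Qnl Cond179)
open B8Eq1123Concrete (Cnl cj_smul_complex)
open B8Ineq125Concrete (C2p C2p_nonneg)
open B8Eq1117Concrete (XSpace)
open B8Eq1117KLevel (dom120_of_119_tower)
open B8DprimeKLevelLipschitz (smallness_prod)
open B8SectEKLevelInLambda (exists_Dprime_kLevel_w Dprime_lipschitz_kLevel_w)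
open B8Ineq132 (covDerivFwd covDeriv norm_conjR)
open B8Eq151V2Divergence (eta_smul_covDerivFwd covDerivFwd_smul)
open B8Eq146AExpansion (covDeriv_smul)
open B8Eq138LandauZd (covLap covDivB QT)
open B8Eq182Proof (gAd)
open B8Eq184Proof (gaugeExp)
open B8Eq188Proof (frakF3)
open B7Eq167Flat (Cond167 InLambda)
open B7Prop1Local (clampCfg)
open B8LambdaSpaceKLevel (wt wt_pos wt_nonneg lamSubK lamOf lamOf_sub norm_lamOf_le weight_mul_norm_covDerivFwd_le norm_cjDiff_lamOf_le
  norm_le_iff norm_sub_le_iff covDerivFwd_sub')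
open B8Prop5ContractionKLevel (Bd2 Mc Kc)
open B8Prop5KLevelLetters (covLap_sub)
open B8Prop5JoinSectE (cjDiff_le_of_weighted covLap_smul ball_sub_119 ball_diff_modulus hH1_tower)

-- `Site` alone could resolve to the torus sites of `Setup.lean`; re-export the `ℤ^d` sites of `B7Prop1Explicit`.
export B7Prop1Explicit (Site)

variable {d : ℕ} {𝔸 : Type*} [CStarAlgebra 𝔸] [Nontrivial 𝔸]

/-! ## §0 File-local scalar bookkeeping -/

section Bookkeeping

omit [Nontrivial 𝔸] in
/-- `‖(−i)·a‖ = ‖a‖`. [folklore] -/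
private theorem norm_negI_smul (a : 𝔸) : ‖(-I) • a‖ = ‖a‖ := by
  rw [norm_smul, norm_neg, Complex.norm_I, one_mul]

omit [Nontrivial 𝔸] in
/-- `i·((−i)·a) = a` and `(−i)·(i·a) = a`. [folklore] -/
private theorem I_smul_negI_smul (a : 𝔸) : I • ((-I) • a) = a ∧ (-I) • (I • a) = a := by
  constructor <;> rw [smul_smul] <;> simp [Complex.I_mul_I]

omit [Nontrivial 𝔸] in
/-- `((−i)·a)* = i·a*` in a C⋆-algebra. [folklore] -/
private theorem star_negI_smul (a : 𝔸) : star ((-I) • a) = I • star a := by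
  rw [star_smul, star_neg, Complex.star_def, Complex.conj_I, neg_neg]

omit [Nontrivial 𝔸] in
/-- `(−i)·a` is Hermitian when `a* = −a`. [folklore] -/
private theorem isSelfAdjoint_negI_smul_of_skew {a : 𝔸} (ha : star a = -a) : IsSelfAdjoint ((-I) • a) := by
  rw [IsSelfAdjoint, star_negI_smul, ha, smul_neg, ← neg_smul]

omit [Nontrivial 𝔸] in
/-- `((−i)·a)* = −((−i)·a)` when `a` is Hermitian: `−iλ` is skew for Hermitian `λ`. [folklore] -/
private theorem star_negI_smul_of_sa {a : 𝔸} (ha : IsSelfAdjoint a) : star ((-I) • a) = -((-I) • a) := by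
  rw [star_negI_smul, ha.star_eq, neg_smul, neg_neg]

end Bookkeeping


/-! ## §1 Inverse-pair witnesses from unitary witnesses; [3]'s remainder covariance at `u₁⁻¹` -/

section Witness

open B7Prop1Local (clampCfg_mem pdev_clampCfg_le)
open B7Prop2Explicit (prop2_unitaryUnits avgIter pdev)
open B8Eq1112Quotient (inLambda_inv)
open B8SectERemainderCovariance (Cnl_negStar_of_witness)

variable {L k : ℕ} {Λs : ℕ → Set (Site d)} {U₀ : Site d → Fin d → 𝔸ˣ} {u₁ : Site d → 𝔸ˣ} {α₀ α₃ α₄ : ℝ}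

/-- **A UNITARY `Λ_j`-WITNESS `ũ` FOR `u₁` GIVES THE UNITARY `Λ_j`-WITNESS `ũ⁻¹` FOR `u₁⁻¹`, SAME `α₃`** (B8 (1.112) p. 95 tacit step «u′ = u₂u₁⁻¹ satisfies
the regularity conditions»; `B8SectEInLambdaWitness.witness_inv_of_unitary` keeping the unitarity that `B8SectERemainderCovariance.Cnl_negStar_of_witness`
asks for): p05 `B8Eq1112Quotient.inLambda_inv` at the clamped background (unitary averaged levels by [3] Prop. 2 under the tower-local (1.33); `α₃ ≤ ¼`).
[cite: Balaban1985RegularSpaces, (1.112) p.95; Balaban1985Averaging, (166)–(167) p.44, Prop. 2 p.26] -/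
theorem witness_inv_unitary_of_unitary (hL : 2 ≤ L) (hU₀ : ∀ x κ, U₀ x κ ∈ unitaryUnits 𝔸)
    (hα : 0 < α₀) (hα3 : C0 d * α₀ ≤ 1 / 3) (hα2 : 2 * α₀ ≤ c2' d L) {j : ℕ} {y : Site d}
    (h33 : pdevOn (tlo L y j) (thi L y j) U₀ < α₀ * (((L : ℝ) ^ j)⁻¹) ^ 2) (hL1 : 1 ≤ L)
    (hα₃ : 0 ≤ α₃) (hα₃' : α₃ ≤ 1 / 4) {ut : Site d → 𝔸ˣ} (hut : ∀ x, ut x ∈ unitaryUnits 𝔸)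
    (hW : InLambda L (clampCfg (tlo L y j) (thi L y j) U₀) ut j α₃ (((L : ℝ) ^ j)⁻¹))
    (hu₁ : ∀ x : Site d, tlo L y j ≤ x → x ≤ thi L y j → u₁ x = ut x) :
    ∃ ut' : Site d → 𝔸ˣ, (∀ x, ut' x ∈ unitaryUnits 𝔸) ∧
      InLambda L (clampCfg (tlo L y j) (thi L y j) U₀) ut' j α₃ (((L : ℝ) ^ j)⁻¹) ∧
      ∀ x : Site d, tlo L y j ≤ x → x ≤ thi L y j → u₁⁻¹ x = ut' x := by
  have hlohi : ∀ i, tlo L y j i ≤ thi L y j i := B8Ineq130.tlo_le_thi hL1 le_rfl j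
  have hUU : ∀ x κ, U₀ x κ ∈ U1 𝔸 := fun x κ => unitaryUnits_le_U1 (hU₀ x κ)
  have hLj : (0 : ℝ) < (L : ℝ) ^ j := by positivity
  have hU₀c : ∀ x κ, clampCfg (tlo L y j) (thi L y j) U₀ x κ ∈ unitaryUnits 𝔸 := clampCfg_mem hU₀
  have h52c : pdev (clampCfg (tlo L y j) (thi L y j) U₀) < α₀ * (((L : ℝ) ^ j)⁻¹) ^ 2 := (pdev_clampCfg_le hlohi hUU).trans_lt h33
  have hV : ∀ i < j, ∀ (x : Site d) (κ : Fin d), avgIter L (clampCfg (tlo L y j) (thi L y j) U₀) i x κ ∈ unitaryUnits 𝔸 :=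
    fun i hi x κ => (prop2_unitaryUnits L hL j _ hU₀c hα hα3 hα2 h52c).2 i hi.le x κ
  have hs : α₃ * (L : ℝ) ^ j * ((L : ℝ) ^ j)⁻¹ ≤ 1 / 4 := by
    rw [mul_assoc, mul_inv_cancel₀ hLj.ne', mul_one]; exact hα₃'
  refine ⟨ut⁻¹, fun x => ?_, inLambda_inv hV hut hW hL1 (by positivity) hα₃ hs, fun x hx hx' => ?_⟩
  · rw [Pi.inv_apply]; exact (unitaryUnits 𝔸).inv_mem (hut x)
  · rw [Pi.inv_apply, Pi.inv_apply, hu₁ x hx hx']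

/-- **THE INVERSE-PAIR WITNESSES AT EVERY POINT OF `𝔅_k`** in the shape `B8SectEKLevelInLambda.exists_Dprime_kLevel_w` reads (Sect. E is run on the
pair `(·, u₁⁻¹)`, route (a″)): from unitary witnesses for `u₁` and the tower-local (1.33); `α₃ ≤ ¼`.
[cite: Balaban1985RegularSpaces, (1.112) p.95, (1.113)–(1.114) p.95; Balaban1985Averaging, (166)–(167) p.44] -/
theorem hwitinv_of_hwit (hL : 2 ≤ L) (hU₀ : ∀ x κ, U₀ x κ ∈ unitaryUnits 𝔸)
    (hα : 0 < α₀) (hα3 : C0 d * α₀ ≤ 1 / 3) (hα4 : 4 * α₀ ≤ c2' d L) (hα₃ : 0 ≤ α₃) (hα₃' : α₃ ≤ 1 / 4)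
    (h33 : ∀ j, j ≤ k → ∀ y ∈ Λs j, pdevOn (tlo L y j) (thi L y j) U₀ < α₀ * (((L : ℝ) ^ j)⁻¹) ^ 2)
    (hwit : ∀ j, j ≤ k → ∀ y ∈ Λs j, ∃ ut : Site d → 𝔸ˣ, (∀ x, ut x ∈ unitaryUnits 𝔸) ∧
      InLambda L (clampCfg (tlo L y j) (thi L y j) U₀) ut j α₃ (((L : ℝ) ^ j)⁻¹) ∧
      ∀ x : Site d, tlo L y j ≤ x → x ≤ thi L y j → u₁ x = ut x) :
    ∀ j, j ≤ k → ∀ y ∈ Λs j, ∃ ut' : Site d → 𝔸ˣ,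
      InLambda L (clampCfg (tlo L y j) (thi L y j) U₀) ut' j α₃ (((L : ℝ) ^ j)⁻¹) ∧
      ∀ x : Site d, tlo L y j ≤ x → x ≤ thi L y j → u₁⁻¹ x = ut' x := by
  intro j hj y hy
  obtain ⟨ut, hun, hW, hag⟩ := hwit j hj y hy
  obtain ⟨ut', -, hW', hag'⟩ := witness_inv_unitary_of_unitary hL hU₀ hα hα3 (by linarith) (h33 j hj y hy) (le_trans (by norm_num) hL)
    hα₃ hα₃' hun hW hag
  exact ⟨ut', hW', hag'⟩

/-- **[3]'S REMAINDER COVARIANCE AT `u₁⁻¹` — THE BINDER `hCequiv` — FROM UNITARY WITNESSES FOR `u₁`**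
(`B8SectERemainderCovariance.Cnl_negStar_inv_of_axial` with the Theorem-4 datum replaced by `hwit`): at every `j ≤ k`, `y ∈ Λ_j` and every `μ` in the
(1.120)-set of the tower `Bʲ(y)`, `C′_j(u₁⁻¹, −μ⋆)(y) = −C′_j(u₁⁻¹, μ)(y)⋆` (`Cnl_negStar_of_witness` at the unitary witness `ũ⁻¹`).
[cite: Balaban1985RegularSpaces, (1.115) p.96, (1.120) p.96, p.93, (1.112) p.95; Balaban1985Averaging, Prop. 10 p.50] -/
theorem Cnl_negStar_inv_of_hwit (Λ : ℕ → Set (Site d)) (hL : 2 ≤ L) (hL1 : 1 ≤ L) (hU₀ : ∀ x κ, U₀ x κ ∈ unitaryUnits 𝔸)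
    (hα : 0 < α₀) (hα3 : C0 d * α₀ ≤ 1 / 3) (hα4 : 4 * α₀ ≤ c2' d L) (hα₃ : 0 ≤ α₃) (hα₄ : 0 < α₄)
    (h33 : ∀ j, j ≤ k → ∀ y ∈ Λ j, pdevOn (tlo L y j) (thi L y j) U₀ < α₀ * (((L : ℝ) ^ j)⁻¹) ^ 2)
    (hwit : ∀ j, j ≤ k → ∀ y ∈ Λ j, ∃ ut : Site d → 𝔸ˣ, (∀ x, ut x ∈ unitaryUnits 𝔸) ∧
      InLambda L (clampCfg (tlo L y j) (thi L y j) U₀) ut j α₃ (((L : ℝ) ^ j)⁻¹) ∧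
      ∀ x : Site d, tlo L y j ≤ x → x ≤ thi L y j → u₁ x = ut x)
    (hα₃' : α₃ ≤ 1 / 50)
    (hs₁ : 10 * C6 d * (4 * α₄) ≤ 1) (hs₂ : 3000 * ((d : ℝ) + 1) * L * (4 * α₄) ≤ 1)
    (hs₃ : C4G d L * (α₀ + α₃ + 4 * α₄) ≤ 1)
    (hs₄ : 1024 * ((d : ℝ) + 1) * ((d : ℝ) + 4) * L ^ 2 * α₀ ≤ 1) (hs₅ : 32 * ((d : ℝ) + 1) ^ 2 * C6 d * L ^ 2 * α₀ ≤ 1)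
    (hs₆ : 16 * d * C5' d * C6 d * (L : ℝ) ^ 2 * α₀ ≤ 1)
    (hprod : 2 * C6 d * (α₃ + 4 * α₄) ≤ 1 / 8) (h204w : C6 d * (4 * α₄) ≤ 1 / 8) :
    ∀ j, j ≤ k → ∀ y ∈ Λ j, ∀ μ : Site d → 𝔸,
      (∀ x : Site d, InBox (tlo L y j) (thi L y j) x → ‖μ x‖ < α₄) →
      (∀ (x : Site d) (κ : Fin d), InBox (tlo L y j) (thi L y j) x → InBox (tlo L y j) (thi L y j) (x + e κ) →
        ‖cj (U₀ x κ) (μ (x + e κ)) - μ x‖ < α₄ * ((L : ℝ) ^ j)⁻¹) →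
      Cnl L U₀ u₁⁻¹ j (fun x => -star (μ x)) y = -star (Cnl L U₀ u₁⁻¹ j μ y) := by
  intro j hj y hy μ hμb hμa
  obtain ⟨ut, hun, hW, hag⟩ := hwit j hj y hy
  obtain ⟨ut', hun', hW', hag'⟩ := witness_inv_unitary_of_unitary hL hU₀ hα hα3 (by linarith) (h33 j hj y hy) hL1 hα₃ (by linarith)
    hun hW hag
  have hy₀ : tlo L y 0 ≤ y := by rw [B8Ineq130.tlo_zero]
  have hy₀' : y ≤ thi L y 0 := by rw [B8Ineq130.thi_zero]
  exact Cnl_negStar_of_witness hL hU₀ hα hα3 (by linarith) (h33 j hj y hy) hL1 hun' hW' hag' hα₄ hμb hμa hα₃ hα₃' hs₁ hs₂ hs₃ hs₄ hs₅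
    hs₆ hprod h204w (m := j) (n := 0) (by omega) y hy₀ hy₀'

end Witness


/-! ## §2 Sect. E's `D′(u₁⁻¹, −i·)` on the ¼α₄-ball for the inverse pair, WITNESS FORM (n04-b's `_w` cores by name) -/

section SectE

variable {L k : ℕ} {η : ℝ} {Λs : ℕ → Set (Site d)} {Eb : ℕ → Set (Site d × Fin d)} {U₀ : Site d → Fin d → 𝔸ˣ}
  {u₁ : Site d → 𝔸ˣ} {α₀ α₃ α₄ B₀' : ℝ}

/-- **SECT. E'S `D′(u₁⁻¹, −iλ_s)` ON THE ¼α₄-BALL OF (1.102), WITNESS FORM** — n04-b's `B8SectEKLevelInLambda.exists_Dprime_kLevel_w` (over n05-b's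
`B8Eq1117KLevel`) BY NAME at `λ_E := −iλ_s` for the inverse pair `(·, u₁⁻¹)` of the (a″) ruling (same background `U₀`; every hypothesis AT `u₁`:
the datum's (1.34) `InAx`, (1.29) `Restr129`, (1.69), unitarity and plaquette regularity of `U₁U₀`): there is `X = D′(−iλ_s)` with `‖X‖ ≤ α₄/(2B′₀)`, `‖X‖ ≤ C2p(α₃ + α₄)α₄`, vanishing off
`𝔅_k`, solving (1.117) `C′_j(u₁⁻¹, −iλ_s − H′X)(y) = X(j, y)` on `𝔅_k`, and (1.114) `Q′_j(u₁⁻¹, e^{−iλ_s − H′X})(y) = (Q′_j(−iλ_s))(y)` there.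
Tower-local regime as in n04-b/n05-b ((1.33) on `Bʲ(y)`, (1.69) `|B_b| ≤ c L^{−j}`, `H′`'s (1.92)₁,₂ and `Q′H′ = I` on `𝔅_k`, the eight windows,
`2048·d·c ≤ 1`, print's «α₃ + α₄ ≦ 1/(4B′₀C′₂)»); tower bonds in `Eb j`.
[cite: Balaban1985RegularSpaces, (1.113)–(1.121) pp.95–97, (1.92) p.91, (1.102) p.93; Balaban1985Averaging, (213)–(214) p.50] -/
theorem sectE_exists_w (hL : 2 ≤ L) (hη : 0 < η) (hU₀ : ∀ x κ, U₀ x κ ∈ unitaryUnits 𝔸) (H' : XSpace d k 𝔸 →ₗ[ℂ] (Site d → 𝔸))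
    (hα : 0 < α₀) (hα3 : C0 d * α₀ ≤ 1 / 3) (hα4 : 4 * α₀ ≤ c2' d L) (hα₃ : 0 ≤ α₃) (hα₄ : 0 < α₄) (hB : 0 < B₀')
    (h33 : ∀ j, j ≤ k → ∀ y ∈ Λs j, pdevOn (tlo L y j) (thi L y j) U₀ < α₀ * (((L : ℝ) ^ j)⁻¹) ^ 2)
    (hwit : ∀ j, j ≤ k → ∀ y ∈ Λs j, ∃ ut : Site d → 𝔸ˣ, (∀ x, ut x ∈ unitaryUnits 𝔸) ∧
      InLambda L (clampCfg (tlo L y j) (thi L y j) U₀) ut j α₃ (((L : ℝ) ^ j)⁻¹) ∧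
      ∀ x : Site d, tlo L y j ≤ x → x ≤ thi L y j → u₁ x = ut x)
    (hEbT : ∀ j, j ≤ k → ∀ y ∈ Λs j, ∀ (x : Site d) (κ : Fin d), InBox (tlo L y j) (thi L y j) x →
      InBox (tlo L y j) (thi L y j) (x + e κ) → (x, κ) ∈ Eb j)
    (hH0 : ∀ (X : XSpace d k 𝔸) (x : Site d), ‖H' X x‖ ≤ B₀' * ‖X‖)
    (hH1 : ∀ j, j ≤ k → ∀ (X : XSpace d k 𝔸), ∀ p ∈ Eb j, wt L η j * ‖covDerivFwd η U₀ p.2 (H' X) p.1‖ ≤ B₀' * ‖X‖)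
    (hQH : ∀ (Y : XSpace d k 𝔸) (j : ℕ) (hj : j ≤ k) (y : Site d), y ∈ Λs j →
      QprimeIter (zdBlocking d L) (bgT L U₀) j (H' Y) y = Y (⟨j, Nat.lt_succ_of_le hj⟩, y))
    (hα₃' : α₃ ≤ 1 / 200)
    (hs₁ : 200 * C6 d * (2 * α₄) ≤ 1) (hs₂ : 12000 * ((d : ℝ) + 1) * L * (2 * α₄) ≤ 1)
    (hs₃ : C4G d L * (α₀ + α₃ + 4 * (2 * α₄)) ≤ 1)
    (hs₄ : 1024 * ((d : ℝ) + 1) * ((d : ℝ) + 4) * L ^ 2 * α₀ ≤ 1) (hs₅ : 32 * ((d : ℝ) + 1) ^ 2 * C6 d * L ^ 2 * α₀ ≤ 1)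
    (hs₆ : 16 * d * C5' d * C6 d * (L : ℝ) ^ 2 * α₀ ≤ 1) (hs₇ : 8 * d * C6 d * L * α₀ ≤ 1)
    (hsm : α₃ + α₄ ≤ 1 / (4 * B₀' * (2 * C2p d)))
    (s : lamSubK η U₀ L k Eb) (hs : ‖s‖ ≤ α₄ / 4) :
    ∃ X : XSpace d k 𝔸, ‖X‖ ≤ α₄ / (2 * B₀') ∧ ‖X‖ ≤ C2p d * (α₃ + α₄) * α₄ ∧
      (∀ (j : ℕ) (hj : j ≤ k) (y : Site d), y ∉ Λs j → X (⟨j, Nat.lt_succ_of_le hj⟩, y) = 0) ∧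
      (∀ (j : ℕ) (hj : j ≤ k) (y : Site d), y ∈ Λs j →
        Cnl L U₀ u₁⁻¹ j ((-I) • lamOf s - H' X) y = X (⟨j, Nat.lt_succ_of_le hj⟩, y)) ∧
      ∀ (j : ℕ), j ≤ k → ∀ y ∈ Λs j,
        Qnl L U₀ (fun x => expUnit (((-I) • lamOf s - H' X) x)) u₁⁻¹ j y =
          QprimeIter (zdBlocking d L) (bgT L U₀) j ((-I) • lamOf s) y := by
  have hL1 : 1 ≤ L := le_trans (by norm_num) hL
  obtain ⟨h119b, h119a⟩ := ball_sub_119 (Λs := Λs) hL1 hη hα₄ hEbT s hs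
  exact exists_Dprime_kLevel_w (Λ := Λs) (lam := (-I) • lamOf s) hL hL1 (avgClosed_unitaryUnits d L) hU₀ hα hα3 hα4 hα₃ hα₄ hB h33
    (hwitinv_of_hwit hL hU₀ hα hα3 hα4 hα₃ (by linarith only [hα₃']) h33 hwit) h119b h119a hH0 (hH1_tower hL1 hη H' hEbT hH1) hQH hα₃'
    hs₁ hs₂ hs₃ hs₄ hs₅ hs₆ hs₇ hsm

/-- **`D′(u₁⁻¹, −iλ)` IS LIPSCHITZ ON THE ¼α₄-BALL WITH THE (1.102) NORM, WITNESS FORM** — n04-b's `B8SectEKLevelInLambda.Dprime_lipschitz_kLevel_w`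
(over n05-b's `B8DprimeKLevelLipschitz.Dprime_lipschitz_kLevel`) BY NAME:
any two solutions `X_s`, `X_t` of (1.117) in the ball `α₄/(2B′₀)` for `−iλ_s`, `−iλ_t` (vanishing off `𝔅_k`) satisfy
`‖X_s − X_t‖ ≤ 4·C2p·(α₃ + 2α₄)·‖s − t‖`.  At `s = t` this is «exactly one solution» (p. 97).
[cite: Balaban1985RegularSpaces, p.97 (after (1.125)), (1.117)–(1.125) pp.96–97, (1.105)–(1.106) p.94] -/
theorem sectE_lipschitz_w (hL : 2 ≤ L) (hη : 0 < η) (hU₀ : ∀ x κ, U₀ x κ ∈ unitaryUnits 𝔸) (H' : XSpace d k 𝔸 →ₗ[ℂ] (Site d → 𝔸))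
    (hα : 0 < α₀) (hα3 : C0 d * α₀ ≤ 1 / 3) (hα4 : 4 * α₀ ≤ c2' d L) (hα₃ : 0 ≤ α₃) (hα₄ : 0 < α₄) (hB : 0 < B₀')
    (h33 : ∀ j, j ≤ k → ∀ y ∈ Λs j, pdevOn (tlo L y j) (thi L y j) U₀ < α₀ * (((L : ℝ) ^ j)⁻¹) ^ 2)
    (hwit : ∀ j, j ≤ k → ∀ y ∈ Λs j, ∃ ut : Site d → 𝔸ˣ, (∀ x, ut x ∈ unitaryUnits 𝔸) ∧
      InLambda L (clampCfg (tlo L y j) (thi L y j) U₀) ut j α₃ (((L : ℝ) ^ j)⁻¹) ∧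
      ∀ x : Site d, tlo L y j ≤ x → x ≤ thi L y j → u₁ x = ut x)
    (hEbT : ∀ j, j ≤ k → ∀ y ∈ Λs j, ∀ (x : Site d) (κ : Fin d), InBox (tlo L y j) (thi L y j) x →
      InBox (tlo L y j) (thi L y j) (x + e κ) → (x, κ) ∈ Eb j)
    (hH0 : ∀ (X : XSpace d k 𝔸) (x : Site d), ‖H' X x‖ ≤ B₀' * ‖X‖)
    (hH1 : ∀ j, j ≤ k → ∀ (X : XSpace d k 𝔸), ∀ p ∈ Eb j, wt L η j * ‖covDerivFwd η U₀ p.2 (H' X) p.1‖ ≤ B₀' * ‖X‖)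
    (hα₃' : α₃ ≤ 1 / 200)
    (hs₁ : 200 * C6 d * (2 * α₄) ≤ 1) (hs₂ : 12000 * ((d : ℝ) + 1) * L * (2 * α₄) ≤ 1)
    (hs₃ : C4G d L * (α₀ + α₃ + 4 * (2 * α₄)) ≤ 1)
    (hs₄ : 1024 * ((d : ℝ) + 1) * ((d : ℝ) + 4) * L ^ 2 * α₀ ≤ 1) (hs₅ : 32 * ((d : ℝ) + 1) ^ 2 * C6 d * L ^ 2 * α₀ ≤ 1)
    (hs₆ : 16 * d * C5' d * C6 d * (L : ℝ) ^ 2 * α₀ ≤ 1) (hs₇ : 8 * d * C6 d * L * α₀ ≤ 1)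
    (hsm : α₃ + α₄ ≤ 1 / (4 * B₀' * (2 * C2p d)))
    (s t : lamSubK η U₀ L k Eb) (hs : ‖s‖ ≤ α₄ / 4) (ht : ‖t‖ ≤ α₄ / 4)
    {X Y : XSpace d k 𝔸} (hXρ : ‖X‖ ≤ α₄ / (2 * B₀')) (hYρ : ‖Y‖ ≤ α₄ / (2 * B₀'))
    (hXzero : ∀ (j : ℕ) (hj : j ≤ k) (y : Site d), y ∉ Λs j → X (⟨j, Nat.lt_succ_of_le hj⟩, y) = 0)
    (hXfix : ∀ (j : ℕ) (hj : j ≤ k) (y : Site d), y ∈ Λs j →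
      Cnl L U₀ u₁⁻¹ j ((-I) • lamOf s - H' X) y = X (⟨j, Nat.lt_succ_of_le hj⟩, y))
    (hYzero : ∀ (j : ℕ) (hj : j ≤ k) (y : Site d), y ∉ Λs j → Y (⟨j, Nat.lt_succ_of_le hj⟩, y) = 0)
    (hYfix : ∀ (j : ℕ) (hj : j ≤ k) (y : Site d), y ∈ Λs j →
      Cnl L U₀ u₁⁻¹ j ((-I) • lamOf t - H' Y) y = Y (⟨j, Nat.lt_succ_of_le hj⟩, y)) :
    ‖X - Y‖ ≤ 4 * C2p d * (α₃ + 2 * α₄) * ‖s - t‖ := by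
  have hL1 : 1 ≤ L := le_trans (by norm_num) hL
  obtain ⟨h₁b, h₁a⟩ := ball_sub_119 (Λs := Λs) hL1 hη hα₄ hEbT s hs
  obtain ⟨h₂b, h₂a⟩ := ball_sub_119 (Λs := Λs) hL1 hη hα₄ hEbT t ht
  obtain ⟨hmb, hma⟩ := ball_diff_modulus (Λs := Λs) hL1 hη hEbT s t
  exact Dprime_lipschitz_kLevel_w (Λ := Λs) (lam₁ := (-I) • lamOf s) (lam₂ := (-I) • lamOf t) hL hL1 (avgClosed_unitaryUnits d L) hU₀ hα
    hα3 hα4 hα₃ hα₄ hB (norm_nonneg _) h33 (hwitinv_of_hwit hL hU₀ hα hα3 hα4 hα₃ (by linarith only [hα₃']) h33 hwit) h₁b h₁a h₂b h₂a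
    hmb hma hH0 (hH1_tower hL1 hη H' hEbT hH1) hα₃' hs₁ hs₂ hs₃ hs₄ hs₅ hs₆ hs₇ hsm hXρ hYρ hXzero hXfix hYzero hYfix

/-- **`D′(u₁⁻¹, −iλ_s)` IS REAL FOR HERMITIAN `λ_s`, WITNESS FORM** (tacit in print, where everything is `U(N)`-valued): if [3]'s remainder `C′_j(u₁⁻¹, ·)` is
covariant under `μ ↦ −μ*` on the (1.120)-set of the tower (`hCequiv`) and [4]'s `H′` under `X ↦ −X*` (`hHequiv`), then for Hermitian `λ_s` the reflected
family `−X*` solves (1.117) for the same `−iλ_s` in the same ball, so by «exactly one solution» (`sectE_lipschitz_w` at `s = t`) `X(j, y)* = −X(j, y)`.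
[cite: Balaban1985RegularSpaces, p.97 (exactly one solution), p.93 (real configurations); Balaban1985Averaging, (22)–(23) p.21, (208) p.50] -/
theorem sectE_real_w (hL : 2 ≤ L) (hη : 0 < η) (hU₀ : ∀ x κ, U₀ x κ ∈ unitaryUnits 𝔸) (H' : XSpace d k 𝔸 →ₗ[ℂ] (Site d → 𝔸))
    (hα : 0 < α₀) (hα3 : C0 d * α₀ ≤ 1 / 3) (hα4 : 4 * α₀ ≤ c2' d L) (hα₃ : 0 ≤ α₃) (hα₄ : 0 < α₄) (hB : 0 < B₀')
    (h33 : ∀ j, j ≤ k → ∀ y ∈ Λs j, pdevOn (tlo L y j) (thi L y j) U₀ < α₀ * (((L : ℝ) ^ j)⁻¹) ^ 2)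
    (hwit : ∀ j, j ≤ k → ∀ y ∈ Λs j, ∃ ut : Site d → 𝔸ˣ, (∀ x, ut x ∈ unitaryUnits 𝔸) ∧
      InLambda L (clampCfg (tlo L y j) (thi L y j) U₀) ut j α₃ (((L : ℝ) ^ j)⁻¹) ∧
      ∀ x : Site d, tlo L y j ≤ x → x ≤ thi L y j → u₁ x = ut x)
    (hEbT : ∀ j, j ≤ k → ∀ y ∈ Λs j, ∀ (x : Site d) (κ : Fin d), InBox (tlo L y j) (thi L y j) x →
      InBox (tlo L y j) (thi L y j) (x + e κ) → (x, κ) ∈ Eb j)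
    (hH0 : ∀ (X : XSpace d k 𝔸) (x : Site d), ‖H' X x‖ ≤ B₀' * ‖X‖)
    (hH1 : ∀ j, j ≤ k → ∀ (X : XSpace d k 𝔸), ∀ p ∈ Eb j, wt L η j * ‖covDerivFwd η U₀ p.2 (H' X) p.1‖ ≤ B₀' * ‖X‖)
    (hHequiv : ∀ X Y : XSpace d k 𝔸, (∀ p, Y p = -star (X p)) → ∀ x, H' Y x = -star (H' X x))
    (hCequiv : ∀ j, j ≤ k → ∀ y ∈ Λs j, ∀ μ : Site d → 𝔸,
      (∀ x : Site d, InBox (tlo L y j) (thi L y j) x → ‖μ x‖ < α₄) →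
      (∀ (x : Site d) (κ : Fin d), InBox (tlo L y j) (thi L y j) x → InBox (tlo L y j) (thi L y j) (x + e κ) →
        ‖cj (U₀ x κ) (μ (x + e κ)) - μ x‖ < α₄ * ((L : ℝ) ^ j)⁻¹) →
      Cnl L U₀ u₁⁻¹ j (fun x => -star (μ x)) y = -star (Cnl L U₀ u₁⁻¹ j μ y))
    (hα₃' : α₃ ≤ 1 / 200)
    (hs₁ : 200 * C6 d * (2 * α₄) ≤ 1) (hs₂ : 12000 * ((d : ℝ) + 1) * L * (2 * α₄) ≤ 1)
    (hs₃ : C4G d L * (α₀ + α₃ + 4 * (2 * α₄)) ≤ 1)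
    (hs₄ : 1024 * ((d : ℝ) + 1) * ((d : ℝ) + 4) * L ^ 2 * α₀ ≤ 1) (hs₅ : 32 * ((d : ℝ) + 1) ^ 2 * C6 d * L ^ 2 * α₀ ≤ 1)
    (hs₆ : 16 * d * C5' d * C6 d * (L : ℝ) ^ 2 * α₀ ≤ 1) (hs₇ : 8 * d * C6 d * L * α₀ ≤ 1)
    (hsm : α₃ + α₄ ≤ 1 / (4 * B₀' * (2 * C2p d)))
    (s : lamSubK η U₀ L k Eb) (hs : ‖s‖ ≤ α₄ / 4) (hsa : ∀ x, IsSelfAdjoint (lamOf s x))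
    {X : XSpace d k 𝔸} (hXρ : ‖X‖ ≤ α₄ / (2 * B₀'))
    (hXzero : ∀ (j : ℕ) (hj : j ≤ k) (y : Site d), y ∉ Λs j → X (⟨j, Nat.lt_succ_of_le hj⟩, y) = 0)
    (hXfix : ∀ (j : ℕ) (hj : j ≤ k) (y : Site d), y ∈ Λs j →
      Cnl L U₀ u₁⁻¹ j ((-I) • lamOf s - H' X) y = X (⟨j, Nat.lt_succ_of_le hj⟩, y)) :
    ∀ p, star (X p) = -X p := by
  have hL1 : 1 ≤ L := le_trans (by norm_num) hL
  -- the reflected family `−X*`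
  have hbd : ∀ p, ‖-star (X p)‖ ≤ ‖X‖ := fun p => by
    rw [norm_neg, norm_star]; exact X.norm_coe_le_norm p
  set Y : XSpace d k 𝔸 := BoundedContinuousFunction.ofNormedAddCommGroupDiscrete (fun p => -star (X p)) ‖X‖ hbd with hYdef
  have hYp : ∀ p, Y p = -star (X p) := fun p => rfl
  have hYρ : ‖Y‖ ≤ α₄ / (2 * B₀') :=
    ((BoundedContinuousFunction.norm_le (norm_nonneg X)).2 fun p => by rw [hYp]; exact hbd p).trans hXρ
  have hYzero : ∀ (j : ℕ) (hj : j ≤ k) (y : Site d), y ∉ Λs j → Y (⟨j, Nat.lt_succ_of_le hj⟩, y) = 0 := fun j hj y hy => by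
    rw [hYp, hXzero j hj y hy, star_zero, neg_zero]
  have hHY : H' Y = fun x => -star (H' X x) := funext (hHequiv X Y hYp)
  have hμ : (-I) • lamOf s - H' Y = fun x => -star (((-I) • lamOf s - H' X) x) := by
    funext x
    rw [hHY, Pi.sub_apply, Pi.smul_apply, Pi.sub_apply, Pi.smul_apply, star_sub, star_negI_smul_of_sa (hsa x)]
    abel
  have hYfix : ∀ (j : ℕ) (hj : j ≤ k) (y : Site d), y ∈ Λs j →
      Cnl L U₀ u₁⁻¹ j ((-I) • lamOf s - H' Y) y = Y (⟨j, Nat.lt_succ_of_le hj⟩, y) := by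
    intro j hj y hy
    obtain ⟨h119b, h119a⟩ := ball_sub_119 (Λs := Λs) hL1 hη hα₄ hEbT s hs
    obtain ⟨ha, hb⟩ := dom120_of_119_tower H' hB (by positivity) hH0 ((hH1_tower hL1 hη H' hEbT hH1) j hj y hy) (h119a j hj y hy)
      (h119b j hj y hy) hXρ
    rw [hμ, hCequiv j hj y hy _ hb ha, hXfix j hj y hy, hYp]
  have hXY := sectE_lipschitz_w hL hη hU₀ H' hα hα3 hα4 hα₃ hα₄ hB h33 hwit hEbT hH0 hH1 hα₃' hs₁ hs₂ hs₃ hs₄ hs₅ hs₆ hs₇ hsm s s hs hs hXρ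
    hYρ hXzero hXfix hYzero hYfix
  rw [sub_self, norm_zero, mul_zero] at hXY
  have hXYeq : X = Y := sub_eq_zero.1 (norm_le_zero_iff.1 hXY)
  intro p
  have h1 : X p = -star (X p) := by rw [← hYp p, ← hXYeq]
  have h2 := congrArg star h1
  rw [star_neg, star_star] at h2
  exact h2


end SectE

/-! ## §2b The solution map `D′`, chosen once, WITNESS FORM -/

section Dp

variable {L k : ℕ} {η : ℝ} {Ω Λs : ℕ → Set (Site d)} {Eb : ℕ → Set (Site d × Fin d)} {U₀ : Site d → Fin d → 𝔸ˣ}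
  {A : Site d → Fin d → 𝔸} {u₁ : Site d → 𝔸ˣ}

/-- **THE MAP `λ ↦ D′(u₁⁻¹, −iλ)` ON THE ¼α₄-BALL, CHOSEN ONCE, WITNESS FORM** (p. 97 «We take D′(λ) equal to this solution»): a function `Dp` on site
functions with, for every `s` in the ¼α₄-ball of (1.102): `Dp λ_s` in the ball `α₄/(2B′₀)`, vanishing off `𝔅_k`, solving (1.117) for `−iλ_s`, of size
`≤ C2p(α₃ + α₄)α₄`, with (1.114) for the inverse pair; Lipschitz `‖Dp λ_s − Dp λ_t‖ ≤ 4C2p(α₃ + 2α₄)‖s − t‖`; and `(Dp λ_s)* = −Dp λ_s` for Hermitian `λ_s`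
(`sectE_exists_w` / `sectE_lipschitz_w` / `sectE_real_w`; the choice is by `Classical.choice`, unique by «exactly one solution»).
[cite: Balaban1985RegularSpaces, (1.113)–(1.121) pp.95–97, p.97 (exactly one solution; analytic function of λ)] -/
theorem exists_Dprime_map_w (hL : 2 ≤ L) (hη : 0 < η) (hU₀ : ∀ x κ, U₀ x κ ∈ unitaryUnits 𝔸) (H' : XSpace d k 𝔸 →ₗ[ℂ] (Site d → 𝔸))
    {α₀ α₃ α₄ B₀' : ℝ}
    (hα : 0 < α₀) (hα3 : C0 d * α₀ ≤ 1 / 3) (hα4 : 4 * α₀ ≤ c2' d L) (hα₃ : 0 ≤ α₃) (hα₄ : 0 < α₄) (hB : 0 < B₀')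
    (h33 : ∀ j, j ≤ k → ∀ y ∈ Λs j, pdevOn (tlo L y j) (thi L y j) U₀ < α₀ * (((L : ℝ) ^ j)⁻¹) ^ 2)
    (hwit : ∀ j, j ≤ k → ∀ y ∈ Λs j, ∃ ut : Site d → 𝔸ˣ, (∀ x, ut x ∈ unitaryUnits 𝔸) ∧
      InLambda L (clampCfg (tlo L y j) (thi L y j) U₀) ut j α₃ (((L : ℝ) ^ j)⁻¹) ∧
      ∀ x : Site d, tlo L y j ≤ x → x ≤ thi L y j → u₁ x = ut x)
    (hEbT : ∀ j, j ≤ k → ∀ y ∈ Λs j, ∀ (x : Site d) (κ : Fin d), InBox (tlo L y j) (thi L y j) x →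
      InBox (tlo L y j) (thi L y j) (x + e κ) → (x, κ) ∈ Eb j)
    (hH0 : ∀ (X : XSpace d k 𝔸) (x : Site d), ‖H' X x‖ ≤ B₀' * ‖X‖)
    (hH1 : ∀ j, j ≤ k → ∀ (X : XSpace d k 𝔸), ∀ p ∈ Eb j, wt L η j * ‖covDerivFwd η U₀ p.2 (H' X) p.1‖ ≤ B₀' * ‖X‖)
    (hHequiv : ∀ X Y : XSpace d k 𝔸, (∀ p, Y p = -star (X p)) → ∀ x, H' Y x = -star (H' X x))
    (hQH : ∀ (Y : XSpace d k 𝔸) (j : ℕ) (hj : j ≤ k) (y : Site d), y ∈ Λs j →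
      QprimeIter (zdBlocking d L) (bgT L U₀) j (H' Y) y = Y (⟨j, Nat.lt_succ_of_le hj⟩, y))
    (hCequiv : ∀ j, j ≤ k → ∀ y ∈ Λs j, ∀ μ : Site d → 𝔸,
      (∀ x : Site d, InBox (tlo L y j) (thi L y j) x → ‖μ x‖ < α₄) →
      (∀ (x : Site d) (κ : Fin d), InBox (tlo L y j) (thi L y j) x → InBox (tlo L y j) (thi L y j) (x + e κ) →
        ‖cj (U₀ x κ) (μ (x + e κ)) - μ x‖ < α₄ * ((L : ℝ) ^ j)⁻¹) →
      Cnl L U₀ u₁⁻¹ j (fun x => -star (μ x)) y = -star (Cnl L U₀ u₁⁻¹ j μ y))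
    (hα₃' : α₃ ≤ 1 / 200)
    (hs₁ : 200 * C6 d * (2 * α₄) ≤ 1) (hs₂ : 12000 * ((d : ℝ) + 1) * L * (2 * α₄) ≤ 1)
    (hs₃ : C4G d L * (α₀ + α₃ + 4 * (2 * α₄)) ≤ 1)
    (hs₄ : 1024 * ((d : ℝ) + 1) * ((d : ℝ) + 4) * L ^ 2 * α₀ ≤ 1) (hs₅ : 32 * ((d : ℝ) + 1) ^ 2 * C6 d * L ^ 2 * α₀ ≤ 1)
    (hs₆ : 16 * d * C5' d * C6 d * (L : ℝ) ^ 2 * α₀ ≤ 1) (hs₇ : 8 * d * C6 d * L * α₀ ≤ 1)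
    (hsm : α₃ + α₄ ≤ 1 / (4 * B₀' * (2 * C2p d))) :
    ∃ Dp : (Site d → 𝔸) → XSpace d k 𝔸,
      (∀ s : lamSubK η U₀ L k Eb, ‖s‖ ≤ α₄ / 4 →
        ‖Dp (lamOf s)‖ ≤ α₄ / (2 * B₀') ∧ ‖Dp (lamOf s)‖ ≤ C2p d * (α₃ + α₄) * α₄ ∧
        (∀ (j : ℕ) (hj : j ≤ k) (y : Site d), y ∉ Λs j → Dp (lamOf s) (⟨j, Nat.lt_succ_of_le hj⟩, y) = 0) ∧
        (∀ (j : ℕ) (hj : j ≤ k) (y : Site d), y ∈ Λs j →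
          Cnl L U₀ u₁⁻¹ j ((-I) • lamOf s - H' (Dp (lamOf s))) y = Dp (lamOf s) (⟨j, Nat.lt_succ_of_le hj⟩, y)) ∧
        ∀ (j : ℕ), j ≤ k → ∀ y ∈ Λs j,
          Qnl L U₀ (fun x => expUnit (((-I) • lamOf s - H' (Dp (lamOf s))) x)) u₁⁻¹ j y =
            QprimeIter (zdBlocking d L) (bgT L U₀) j ((-I) • lamOf s) y) ∧
      (∀ s t : lamSubK η U₀ L k Eb, ‖s‖ ≤ α₄ / 4 → ‖t‖ ≤ α₄ / 4 →
        ‖Dp (lamOf s) - Dp (lamOf t)‖ ≤ 4 * C2p d * (α₃ + 2 * α₄) * ‖s - t‖) ∧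
      ∀ s : lamSubK η U₀ L k Eb, ‖s‖ ≤ α₄ / 4 → (∀ x, IsSelfAdjoint (lamOf s x)) → ∀ p, star (Dp (lamOf s) p) = -Dp (lamOf s) p := by
  -- a solution with all the listed properties at each λ_s of the ball, chosen once
  have key : ∀ lam : Site d → 𝔸, ∃ X : XSpace d k 𝔸, ∀ s : lamSubK η U₀ L k Eb, lamOf s = lam → ‖s‖ ≤ α₄ / 4 →
      ‖X‖ ≤ α₄ / (2 * B₀') ∧ ‖X‖ ≤ C2p d * (α₃ + α₄) * α₄ ∧
      (∀ (j : ℕ) (hj : j ≤ k) (y : Site d), y ∉ Λs j → X (⟨j, Nat.lt_succ_of_le hj⟩, y) = 0) ∧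
      (∀ (j : ℕ) (hj : j ≤ k) (y : Site d), y ∈ Λs j →
        Cnl L U₀ u₁⁻¹ j ((-I) • lamOf s - H' X) y = X (⟨j, Nat.lt_succ_of_le hj⟩, y)) ∧
      ∀ (j : ℕ), j ≤ k → ∀ y ∈ Λs j,
        Qnl L U₀ (fun x => expUnit (((-I) • lamOf s - H' X) x)) u₁⁻¹ j y = QprimeIter (zdBlocking d L) (bgT L U₀) j ((-I) • lamOf s) y := by
    intro lam
    by_cases h : ∃ s : lamSubK η U₀ L k Eb, lamOf s = lam ∧ ‖s‖ ≤ α₄ / 4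
    · obtain ⟨s, rfl, hs⟩ := h
      obtain ⟨X, hX⟩ := sectE_exists_w hL hη hU₀ H' hα hα3 hα4 hα₃ hα₄ hB h33 hwit hEbT hH0 hH1 hQH hα₃' hs₁ hs₂ hs₃ hs₄ hs₅ hs₆ hs₇ hsm
        s hs
      refine ⟨X, fun t ht _ => ?_⟩
      rw [B8LambdaSpaceKLevel.ext_of_lamOf ht]
      exact hX
    · exact ⟨0, fun s h1 h2 => absurd ⟨s, h1, h2⟩ h⟩
  choose Dp hDp' using key
  have hDp := fun (s : lamSubK η U₀ L k Eb) (hs : ‖s‖ ≤ α₄ / 4) => hDp' (lamOf s) s rfl hs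
  refine ⟨Dp, hDp, fun s t hs ht => ?_, fun s hs hsa => ?_⟩
  · exact sectE_lipschitz_w hL hη hU₀ H' hα hα3 hα4 hα₃ hα₄ hB h33 hwit hEbT hH0 hH1 hα₃' hs₁ hs₂ hs₃ hs₄ hs₅ hs₆ hs₇ hsm s t hs ht (hDp s hs).1
      (hDp t ht).1 (hDp s hs).2.2.1 (hDp s hs).2.2.2.1 (hDp t ht).2.2.1 (hDp t ht).2.2.2.1
  · exact sectE_real_w hL hη hU₀ H' hα hα3 hα4 hα₃ hα₄ hB h33 hwit hEbT hH0 hH1 hHequiv hCequiv hα₃' hs₁ hs₂ hs₃ hs₄ hs₅ hs₆ hs₇ hsm s hs hsa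
      (hDp s hs).1 (hDp s hs).2.2.1 (hDp s hs).2.2.2.1


end Dp

/-! ## §3 JOIN-B with the local inversion route, inverse laws on print's domains, WITNESS FORM -/

section Local

open B8Restr129InversionLocal (restr129_mul_inv_of_cond179_local)
open B8Prop5GaugeParamKLevel (gaugeParam_kLevel gpar_size)
open B8Prop5ContractionKLevel (Zsol Vop Wsrc PsiP5)
open B8Prop5KLevelLetters (multiplier_iff_of_whyZ)
open B8Eq195Linear (proj325_sub)
open B8Eq195LinearRange (q_g_proj325_range)
open B8Eq188Proof (gAd_neg)
open B8Prop5JoinHFP (covLap_neg')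

variable {L k : ℕ} {η : ℝ} {Ω Λs : ℕ → Set (Site d)} {Eb : ℕ → Set (Site d × Fin d)} {U₀ : Site d → Fin d → 𝔸ˣ}
  {A : Site d → Fin d → 𝔸} {u₁ : Site d → 𝔸ˣ}

/-- **(1.29) FOR `u₁·e^{iλ′}` BY THE LOCAL INVERSION ROUTE, WITNESS FORM** (n04-b's `B8Restr129InversionLocal.restr129_mul_inv_of_cond179_local` BY NAME,
its unitary `Λ_j`-witnesses a HYPOTHESIS `hwit` (e.g. print's datum via `B8Prop5WitnessOfDatum.hwit_unitary_of_datum`, or Theorem 4's inductive `u₁` via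
`witness_unitary_of_glev` ∘ `glev_on_towers_of_axial`), with (1.29) `Restr129` for `u₁`): for `λ′ = λ_s + H_cλ_s` on the ¼α₄-ball, `H_c` with sup-size `h₀ ≤ ¾α₄` and
`Eb`-gradient size `h₁ ≤ ¾α₄`, the (207)-bounds of `−iλ′` on the towers hold at `2α₄`, so «`Q′(u₁⁻¹, e^{−iλ′}) = 0` on `𝔅_k`» (`Cond179`) gives
`Restr129 L k Λ U₀ (u₁ · e^{iλ′})`.  Regime: unitary data, (1.33) on the towers, tower bonds in `Eb j`, `α₃ ≤ 1/200`, r04's Prop-10 windows at `8α₄` and `2C₆(α₃ + 8α₄) < ½`.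
No hypothesis at `u₁⁻¹`, nothing global, no small field `B`.
[cite: Balaban1985RegularSpaces, (1.29) p.81, (1.78)–(1.79) p.90, (1.108) p.94, (1.112)–(1.113) p.95; Balaban1985Averaging, Prop. 10 (203)–(204) p.50] -/
theorem restr129_mul_gaugeExp_local_w (hL : 2 ≤ L) (hη : 0 < η) (hU₀ : ∀ x κ, U₀ x κ ∈ unitaryUnits 𝔸)
    (hEbT : ∀ j, j ≤ k → ∀ y ∈ Λs j, ∀ (x : Site d) (κ : Fin d), InBox (tlo L y j) (thi L y j) x →
      InBox (tlo L y j) (thi L y j) (x + e κ) → (x, κ) ∈ Eb j)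
    {α₀ α₃ α₄ h₀ h₁ : ℝ}
    (hα : 0 < α₀) (hα3 : C0 d * α₀ ≤ 1 / 3) (hα4 : 4 * α₀ ≤ c2' d L) (hα₃ : 0 ≤ α₃) (hα₄ : 0 < α₄)
    (h33 : ∀ j, j ≤ k → ∀ y ∈ Λs j, pdevOn (tlo L y j) (thi L y j) U₀ < α₀ * (((L : ℝ) ^ j)⁻¹) ^ 2)
    (hwit : ∀ j, j ≤ k → ∀ y ∈ Λs j, ∃ ut : Site d → 𝔸ˣ, (∀ x, ut x ∈ unitaryUnits 𝔸) ∧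
      InLambda L (clampCfg (tlo L y j) (thi L y j) U₀) ut j α₃ (((L : ℝ) ^ j)⁻¹) ∧
      ∀ x : Site d, tlo L y j ≤ x → x ≤ thi L y j → u₁ x = ut x)
    (h129 : Restr129 L k Λs U₀ u₁) (hα₃' : α₃ ≤ 1 / 200)
    (hw₁ : 10 * C6 d * (4 * (2 * α₄)) ≤ 1) (hw₂ : 3000 * ((d : ℝ) + 1) * L * (4 * (2 * α₄)) ≤ 1)
    (hw₃ : C4G d L * (α₀ + α₃ + 4 * (2 * α₄)) ≤ 1)
    (hw₄ : 1024 * ((d : ℝ) + 1) * ((d : ℝ) + 4) * L ^ 2 * α₀ ≤ 1) (hw₅ : 32 * ((d : ℝ) + 1) ^ 2 * C6 d * L ^ 2 * α₀ ≤ 1)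
    (hw₆ : 16 * d * C5' d * C6 d * (L : ℝ) ^ 2 * α₀ ≤ 1) (hprod : 2 * C6 d * (α₃ + 4 * (2 * α₄)) < 1 / 2)
    -- the correction H_c: sup and Eb-gradient sizes on the ¼α₄-ball
    (Hc : (Site d → 𝔸) → (Site d → 𝔸)) (hh₀' : h₀ ≤ 3 * α₄ / 4) (hh₁' : h₁ ≤ 3 * α₄ / 4)
    (hc0 : ∀ s : lamSubK η U₀ L k Eb, ‖s‖ ≤ α₄ / 4 → ∀ x, ‖Hc (lamOf s) x‖ ≤ h₀)
    (hc1 : ∀ s : lamSubK η U₀ L k Eb, ‖s‖ ≤ α₄ / 4 → ∀ j, j ≤ k → ∀ p ∈ Eb j, wt L η j * ‖covDerivFwd η U₀ p.2 (Hc (lamOf s)) p.1‖ ≤ h₁)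
    (s : lamSubK η U₀ L k Eb) (hs : ‖s‖ ≤ α₄ / 4)
    (h179' : Cond179 L k Λs U₀ (fun x => expUnit (((-I) • (lamOf s + Hc (lamOf s))) x)) u₁⁻¹) :
    Restr129 L k Λs U₀ (u₁ * gaugeExp (lamOf s + Hc (lamOf s))) := by
  have hL1 : 1 ≤ L := le_trans (by norm_num) hL
  have hα2 : 2 * α₀ ≤ c2' d L := by linarith
  set lam' := lamOf s + Hc (lamOf s) with hlam'
  -- (207) for −iλ′ on the towers at 2α₄
  have h177b : ∀ j, j ≤ k → ∀ y ∈ Λs j, ∀ x : Site d, InBox (tlo L y j) (thi L y j) x → ‖((-I) • lam') x‖ < 2 * α₄ := by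
    intro j _ y _ x _
    rw [Pi.smul_apply, norm_negI_smul]
    exact (gpar_size hc0 s hs x).trans_lt (by linarith)
  have h177a : ∀ j, j ≤ k → ∀ y ∈ Λs j, ∀ (x : Site d) (κ : Fin d), InBox (tlo L y j) (thi L y j) x →
      InBox (tlo L y j) (thi L y j) (x + e κ) → ‖cj (U₀ x κ) (((-I) • lam') (x + e κ)) - ((-I) • lam') x‖ < 2 * α₄ * ((L : ℝ) ^ j)⁻¹ := by
    intro j hj y hy x κ hx hxe
    have hLj : (0 : ℝ) < ((L : ℝ) ^ j)⁻¹ := by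
      have : (0 : ℝ) < L := by exact_mod_cast hL1
      positivity
    have hb : (x, κ) ∈ Eb j := hEbT j hj y hy x κ hx hxe
    have hgrad : wt L η j * ‖covDerivFwd η U₀ κ lam' x‖ ≤ α₄ / 4 + h₁ := by
      have h1 : wt L η j * ‖covDerivFwd η U₀ κ (lamOf s) x‖ ≤ ‖s‖ := weight_mul_norm_covDerivFwd_le hη.le s hj hb
      have h2 : wt L η j * ‖covDerivFwd η U₀ κ (Hc (lamOf s)) x‖ ≤ h₁ := hc1 s hs j hj (x, κ) hb
      have hw : 0 ≤ wt L η j := wt_nonneg L hη.le j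
      have h3 : ‖covDerivFwd η U₀ κ lam' x‖ ≤ ‖covDerivFwd η U₀ κ (lamOf s) x‖ + ‖covDerivFwd η U₀ κ (Hc (lamOf s)) x‖ := by
        rw [hlam', B8LambdaSpaceKLevel.covDerivFwd_add']; exact norm_add_le _ _
      have h4 := mul_le_mul_of_nonneg_left h3 hw
      rw [mul_add] at h4
      linarith only [h4, h1, h2, hs]
    rw [Pi.smul_apply, Pi.smul_apply, cj_smul_complex, ← smul_sub, norm_negI_smul]
    calc ‖cj (U₀ x κ) (lam' (x + e κ)) - lam' x‖ ≤ (α₄ / 4 + h₁) * ((L : ℝ) ^ j)⁻¹ := cjDiff_le_of_weighted hL1 hη hgrad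
      _ < 2 * α₄ * ((L : ℝ) ^ j)⁻¹ := mul_lt_mul_of_pos_right (by linarith) hLj
  have h := restr129_mul_inv_of_cond179_local (Λ := Λs) (lam := (-I) • lam') hL hL1 hU₀ hα hα3 hα2 hα₃ (by linarith) (by positivity)
    h33 hwit h177b h177a hw₁ hw₂ hw₃ hw₄ hw₅ hw₆ hprod h129 h179'
  have hfun : (fun x => expUnit (((-I) • lam') x))⁻¹ = gaugeExp lam' := by
    funext x
    rw [Pi.inv_apply, val_inv_expUnit, Pi.smul_apply, neg_smul, neg_neg]
    rfl
  rw [hfun] at h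
  exact h

/-- **JOIN-B WITH THE LOCAL INVERSION ROUTE, [4]'s INVERSE LAWS ON PRINT'S DOMAINS, WITNESS FORM** — `B8Prop5JoinSectELocalRD.hFP_kLevel_of179_local_RD`
VERBATIM except that the Theorem-4 datum binders (`hBu h69 hP hAx` + the glev windows `hsmall hc₃ hsc`, `α₃ = 40d·c_B`) are REPLACED by the unitary
`Λ_j`-witnesses `hwit` with a free class constant `α₃ ≤ 1/200` (the (1.29)-clause by `restr129_mul_gaugeExp_local_w`).  As there: NO
left-inverse law of `G′` (unused); the right-inverse law POINTWISE ON `Ω₀`, `g_rightΩ : ∀ x, ∀ y ∈ Ω₀, (Δ(G′x) + Q′ᵀ𝔄Q′(G′x))(y) = x(y)` ([4] Thm 3.1: `G′` inverts the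
Dirichlet operator on functions on the region; dag-ref-A W8′); the law of `C` in range form `c_range` ((3.25); W8).  «Q′λ_s = 0» by `q_g_proj325_range`; «ΔG′R = R» and
the multiplier identity read at sites of `Ω₀`; the contraction (JOIN-A `gaugeParam_kLevel`), the projection laws (`Q′λ = 0`, `Δλ = R(−Z)`), the
multiplier form via `multiplier_iff_of_whyZ` — verbatim — and the (1.29)-clause from «`Q′(u₁⁻¹, e^{−iλ′}) = 0`» (`h179E`, Sect. E's (1.114) in its
printed use, for the abstract `H_c`) by the witness-form local lemma.  `H_c` is still a LETTER here (eight binders); §4 instantiates it. [cite: Balaban1985RegularSpaces, Prop. 5 (1.107)–(1.109) p.94, (1.95)–(1.106) pp.92–94,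
(1.113)–(1.114) p.95, (1.78)–(1.79) p.90, (1.29) p.81] -/
theorem hFP_kLevel_of179_local_RD_w (hL : 2 ≤ L) (hη : 0 < η) (hU₀ : ∀ x κ, U₀ x κ ∈ unitaryUnits 𝔸)
    (hEbΩ : ∀ j, j ≤ k → ∀ x ∈ Ω j, ∀ μ : Fin d, (x, μ) ∈ Eb j ∧ (x - e μ, μ) ∈ Eb j)
    (hEbT : ∀ j, j ≤ k → ∀ y ∈ Λs j, ∀ (x : Site d) (κ : Fin d), InBox (tlo L y j) (thi L y j) x →
      InBox (tlo L y j) (thi L y j) (x + e κ) → (x, κ) ∈ Eb j)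
    -- letters of [4]
    (g Δ : (Site d → 𝔸) →ₗ[ℂ] (Site d → 𝔸)) (q : (Site d → 𝔸) →ₗ[ℂ] (ℕ → Site d → 𝔸)) (qs : (ℕ → Site d → 𝔸) →ₗ[ℂ] (Site d → 𝔸))
    (Aw c : (ℕ → Site d → 𝔸) →ₗ[ℂ] (ℕ → Site d → 𝔸))
    (g_rightΩ : ∀ x, ∀ y ∈ Ω 0, (Δ (g x) + qs (Aw (q (g x)))) y = x y)
    (c_range : ∀ f, q (g (g (qs (c (q f))))) = q f)
    (hΔ : ∀ (f : Site d → 𝔸), ∀ x ∈ Ω 0, Δ f x = covLap η U₀ ((Ω 0).indicator f) x)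
    (hqs : ∀ (μ : ℕ → Site d → 𝔸), ∀ x ∈ Ω 0, qs μ x = QT L k Λs U₀ μ x)
    (Hc : (Site d → 𝔸) → (Site d → 𝔸))
    -- the tower-local regime of the inversion route, WITNESS FORM (datum AT u₁: (1.33), unitary Λ_j-witnesses, (1.29))
    {α₀ α₃ : ℝ}
    (hα : 0 < α₀) (hα3 : C0 d * α₀ ≤ 1 / 3) (hα4 : 4 * α₀ ≤ c2' d L) (hα₃ : 0 ≤ α₃)
    (h33 : ∀ j, j ≤ k → ∀ y ∈ Λs j, pdevOn (tlo L y j) (thi L y j) U₀ < α₀ * (((L : ℝ) ^ j)⁻¹) ^ 2)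
    (hwit : ∀ j, j ≤ k → ∀ y ∈ Λs j, ∃ ut : Site d → 𝔸ˣ, (∀ x, ut x ∈ unitaryUnits 𝔸) ∧
      InLambda L (clampCfg (tlo L y j) (thi L y j) U₀) ut j α₃ (((L : ℝ) ^ j)⁻¹) ∧
      ∀ x : Site d, tlo L y j ≤ x → x ≤ thi L y j → u₁ x = ut x)
    (h129 : Restr129 L k Λs U₀ u₁) (hα₃' : α₃ ≤ 1 / 200)
    {α₄ BG BR h₀ h₁ h₂ l₀ l₁ l₂ cA cDA : ℝ}
    (hw₁ : 10 * C6 d * (4 * (2 * α₄)) ≤ 1) (hw₂ : 3000 * ((d : ℝ) + 1) * L * (4 * (2 * α₄)) ≤ 1)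
    (hw₃ : C4G d L * (α₀ + α₃ + 4 * (2 * α₄)) ≤ 1)
    (hw₄ : 1024 * ((d : ℝ) + 1) * ((d : ℝ) + 4) * L ^ 2 * α₀ ≤ 1) (hw₅ : 32 * ((d : ℝ) + 1) ^ 2 * C6 d * L ^ 2 * α₀ ≤ 1)
    (hw₆ : 16 * d * C5' d * C6 d * (L : ℝ) ^ 2 * α₀ ≤ 1) (hprod : 2 * C6 d * (α₃ + 4 * (2 * α₄)) < 1 / 2)
    -- JOIN-B's windows, letters G′/R, H_c's eight binders, the datum
    (hα₄ : 0 < α₄) (hBG : 0 ≤ BG) (hBR : 0 ≤ BR) (hh₀ : 0 ≤ h₀) (hh₂ : 0 ≤ h₂) (hl₀ : 0 ≤ l₀) (hl₁ : 0 ≤ l₁)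
    (hl₂ : 0 ≤ l₂) (hcA : 0 ≤ cA) (hcA' : cA ≤ 1 / 13) (hcDA : 0 ≤ cDA)
    (ha₁' : α₄ / 4 + h₀ ≤ 1 / 24) (hb₁' : α₄ / 4 + h₁ ≤ 1 / 140) (hb₁ : 0 < α₄ / 4 + h₁) (hθ : 10 * (α₄ / 4 + h₀) * BR ≤ 1 / 2)
    (hh₀' : h₀ ≤ 3 * α₄ / 4) (hh₁' : h₁ ≤ 3 * α₄ / 4)
    (hG : ∀ (f : Site d → 𝔸) (m : ℝ), 0 ≤ m → Bd2 L η k Ω f m →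
      (∀ x, ‖g f x‖ ≤ BG * m) ∧ ∀ j, j ≤ k → ∀ p ∈ Eb j, wt L η j * ‖covDerivFwd η U₀ p.2 (g f) p.1‖ ≤ BG * m)
    (hGsupp : ∀ (f : Site d → 𝔸) (x : Site d), x ∉ Ω 0 → g f x = 0)
    (hGreal : ∀ f : Site d → 𝔸, (∀ j, j ≤ k → ∀ x ∈ Ω j, IsSelfAdjoint (f x)) → ∀ x, IsSelfAdjoint (g f x))
    (hRbd : ∀ (f : Site d → 𝔸) (m : ℝ), 0 ≤ m → Bd2 L η k Ω f m → Bd2 L η k Ω (f - g (qs (c (q (g f))))) (BR * m))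
    (hRreal : ∀ f : Site d → 𝔸, (∀ j, j ≤ k → ∀ x ∈ Ω j, IsSelfAdjoint (f x)) →
      ∀ j, j ≤ k → ∀ x ∈ Ω j, IsSelfAdjoint ((f - g (qs (c (q (g f))))) x))
    (hc0 : ∀ s : lamSubK η U₀ L k Eb, ‖s‖ ≤ α₄ / 4 → ∀ x, ‖Hc (lamOf s) x‖ ≤ h₀)
    (hc1 : ∀ s : lamSubK η U₀ L k Eb, ‖s‖ ≤ α₄ / 4 → ∀ j, j ≤ k → ∀ p ∈ Eb j, wt L η j * ‖covDerivFwd η U₀ p.2 (Hc (lamOf s)) p.1‖ ≤ h₁)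
    (hc2 : ∀ s : lamSubK η U₀ L k Eb, ‖s‖ ≤ α₄ / 4 → Bd2 L η k Ω (covLap η U₀ (Hc (lamOf s))) h₂)
    (hcL0 : ∀ s t : lamSubK η U₀ L k Eb, ‖s‖ ≤ α₄ / 4 → ‖t‖ ≤ α₄ / 4 → ∀ x, ‖Hc (lamOf s) x - Hc (lamOf t) x‖ ≤ l₀ * ‖s - t‖)
    (hcL1 : ∀ s t : lamSubK η U₀ L k Eb, ‖s‖ ≤ α₄ / 4 → ‖t‖ ≤ α₄ / 4 → ∀ j, j ≤ k → ∀ p ∈ Eb j,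
      wt L η j * ‖covDerivFwd η U₀ p.2 (Hc (lamOf s) - Hc (lamOf t)) p.1‖ ≤ l₁ * ‖s - t‖)
    (hcL2 : ∀ s t : lamSubK η U₀ L k Eb, ‖s‖ ≤ α₄ / 4 → ‖t‖ ≤ α₄ / 4 →
      Bd2 L η k Ω (covLap η U₀ (Hc (lamOf s)) - covLap η U₀ (Hc (lamOf t))) (l₂ * ‖s - t‖))
    (hcsa : ∀ s : lamSubK η U₀ L k Eb, ‖s‖ ≤ α₄ / 4 → (∀ x, IsSelfAdjoint (lamOf s x)) → ∀ x, IsSelfAdjoint (Hc (lamOf s) x))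
    (hcsupp : ∀ s : lamSubK η U₀ L k Eb, ‖s‖ ≤ α₄ / 4 → ∀ x, x ∉ Ω 0 → Hc (lamOf s) x = 0)
    (hDA : Bd2 L η k Ω (fun y => covDivB η U₀ A y) cDA) (hDAsa : ∀ j, j ≤ k → ∀ x ∈ Ω j, IsSelfAdjoint (covDivB η U₀ A x))
    (hA : ∀ j, j ≤ k → ∀ x ∈ Ω j, ∀ μ : Fin d,
      wt L η j * ‖A x μ‖ ≤ cA ∧ wt L η j * ‖conjR (U₀ (x - e μ) μ)⁻¹ (A (x - e μ) μ)‖ ≤ cA)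
    (hAsa : ∀ x μ, IsSelfAdjoint (A x μ))
    (h103 : BG * Mc d BR (α₄ / 4 + h₁) cA h₂ cDA ≤ α₄ / 4)
    (h106 : BG * Kc d BR (α₄ / 4 + h₁) cA h₂ cDA l₂ (1 + l₀) (1 + l₁) ≤ 1 / 2)
    -- Sect. E's (1.114) in its printed use, for the inverse pair, at the abstract H_c
    (h179E : ∀ s : lamSubK η U₀ L k Eb, ‖s‖ ≤ α₄ / 4 → q (lamOf s) = 0 →
      Cond179 L k Λs U₀ (fun x => expUnit (((-I) • (lamOf s + Hc (lamOf s))) x)) u₁⁻¹) :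
    ∃ lam : Site d → 𝔸, (∀ x, IsSelfAdjoint (lam x)) ∧ (∀ x, x ∉ Ω 0 → lam x = 0) ∧
      (∀ j, j ≤ k → ∀ p ∈ Eb j, ‖lam p.1‖ ≤ α₄ ∧ wt L η j * ‖covDerivFwd η U₀ p.2 lam p.1‖ ≤ α₄) ∧
      (∃ μ : ℕ → Site d → 𝔸, ∀ x ∈ Ω 0,
        covLap η U₀ ((Ω 0).indicator fun y => covDivB η U₀ A y + covLap η U₀ lam y +
          ((conjR (gaugeExp lam y)⁻¹ (covDivB η U₀ A y) - covDivB η U₀ A y) +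
            (gAd (covLap η U₀ lam y) (lam y) - covLap η U₀ lam y) + ∑ μ, frakF3 η U₀ lam A y μ)) x = QT L k Λs U₀ μ x) ∧
      Restr129 L k Λs U₀ (u₁ * gaugeExp lam) := by
  have hL1 : 1 ≤ L := le_trans (by norm_num) hL
  -- the letter R of (1.95)
  set R : (Site d → 𝔸) → (Site d → 𝔸) := fun f => f - g (qs (c (q (g f)))) with hRdef
  have hR : ∀ f, R f = f - g (qs (c (q (g f)))) := fun f => rfl
  have hRsub : ∀ f f' : Site d → 𝔸, R (f - f') = R f - R f' := proj325_sub (R := R) hR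
  have hR0 : R 0 = 0 := by rw [hR]; simp
  have hRneg : ∀ f : Site d → 𝔸, R (-f) = -R f := fun f => by rw [← zero_sub, hRsub, hR0, zero_sub]
  -- JOIN-A
  obtain ⟨s, s', hs, hfix, hs', hn', hsa', hoff', hN⟩ := gaugeParam_kLevel (Ω := Ω) (Eb := Eb) (U₀ := U₀) (A := A)
    (DA := fun y => covDivB η U₀ A y) hL1 hη hU₀ hEbΩ (⇑g) R Hc hα₄.le hBG hBR hh₀ hh₂ hl₀ hl₁ hl₂ hcA hcA' hcDA ha₁' hb₁' hb₁ hθ hh₀'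
    hh₁' hG (fun f f' => map_sub g f f') hGsupp hGreal hRsub hRbd hRreal hc0 hc1 hc2 hcL0 hcL1 hcL2 hcsa hcsupp hDA hDAsa hA hAsa h103 h106
  set lam' := lamOf s' with hlam'def
  have hgp : lamOf s + Hc (lamOf s) = lam' := hs'.symm
  -- the Neumann solution at λ′
  set Z : Site d → 𝔸 := Zsol (Wsrc η U₀ A (fun y => covDivB η U₀ A y) lam' (covLap η U₀ (Hc (lamOf s)))) (Vop lam') R with hZdef
  -- the fixed point read through the projection laws: Q′λ = 0 and Δλ = R(−Z)
  have hfix' : lamOf s = g (R (fun x => -Z x)) := by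
    have h := hfix
    simp only [PsiP5] at h
    rw [hgp] at h
    exact h
  have hfix'' : lamOf s = g (R (-Z)) := hfix'
  have hqR : q (g (R (-Z))) = 0 := q_g_proj325_range (R := R) hR c_range (-Z)
  have hq : q (lamOf s) = 0 := by rw [hfix'']; exact hqR
  -- «ΔG′R = R» read POINTWISE on Ω₀ (the right-inverse law of G′ on print's domain)
  have hΔs : ∀ y ∈ Ω 0, Δ (lamOf s) y = R (-Z) y := fun y hy => by
    have h1 := g_rightΩ (R (-Z)) y hy
    rw [hqR, map_zero, map_zero, add_zero] at h1
    rw [hfix'']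
    exact h1
  -- sizes at λ′ on Ω₀
  have hl : ∀ y ∈ Ω 0, ‖lam' y‖ ≤ 1 / 12 := fun y _ => by
    rw [← hgp]; exact (gpar_size hc0 s hs y).trans (ha₁'.trans (by norm_num))
  -- support of λ_s (Dirichlet range of G′)
  have hoff : ∀ x, x ∉ Ω 0 → lamOf s x = 0 := fun x hx => by rw [hfix'']; exact hGsupp _ x hx
  have hind : (Ω 0).indicator (lamOf s) = lamOf s := by
    funext x
    by_cases hx : x ∈ Ω 0
    · rw [Set.indicator_of_mem hx]
    · rw [Set.indicator_of_notMem hx, hoff x hx]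
  refine ⟨lam', hsa', hoff', fun j hj p hp => ?_, ?_, ?_⟩
  · -- (1.108)
    have h := (norm_le_iff hη.le s' hα₄.le).1 hn'
    exact ⟨h.1 p.1, h.2 j hj p hp⟩
  · -- the multiplier clause, via n04-b's WHY-Z bridge
    have hdef : lam' = lamOf s - (-Hc (lamOf s)) := by rw [sub_neg_eq_add, hgp]
    have hNy : ∀ y ∈ Ω 0, Z y + (gAd (R Z y) (lam' y) - R Z y) =
        conjR (gaugeExp lam' y)⁻¹ (covDivB η U₀ A y) - gAd (covLap η U₀ (-Hc (lamOf s)) y) (lam' y) + ∑ μ, frakF3 η U₀ lam' A y μ := by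
      intro y hy
      have h := hN 0 (Nat.zero_le _) y hy
      simp only [Vop, Wsrc] at h
      rw [h, covLap_neg', gAd_neg _ (hl y hy), sub_neg_eq_add]
    have hΔy : ∀ y ∈ Ω 0, covLap η U₀ (lamOf s) y = -R Z y := by
      intro y hy
      rw [← hind, ← hΔ _ y hy, hΔs y hy, hRneg, Pi.neg_apply]
    refine (multiplier_iff_of_whyZ L k (Ω 0) Λs U₀ A hdef hl hNy hΔy).2 ?_
    set φ := c (q (g Z)) with hφ
    refine ⟨φ - Aw (q (g (qs φ))), fun x hx => ?_⟩
    have hZR : Z - R Z = g (qs φ) := by rw [hR]; abel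
    -- «ΔG′Q′ᵀφ = Q′ᵀ(φ − 𝔄Q′G′Q′ᵀφ)» read POINTWISE on Ω₀
    have hlap : Δ (g (qs φ)) x = qs (φ - Aw (q (g (qs φ)))) x := by
      rw [map_sub, Pi.sub_apply]
      exact eq_sub_of_add_eq (by rw [← Pi.add_apply]; exact g_rightΩ (qs φ) x hx)
    rw [← hΔ _ x hx, hZR, hlap, hqs _ x hx]
  · -- (1.29) for u₁·e^{iλ′} by the LOCAL inversion route
    rw [← hgp]
    exact restr129_mul_gaugeExp_local_w hL hη hU₀ hEbT hα hα3 hα4 hα₃ hα₄ h33 hwit h129 hα₃' hw₁ hw₂ hw₃ hw₄ hw₅ hw₆ hprod Hc hh₀' hh₁'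
      hc0 hc1 s hs (h179E s hs hq)



end Local

/-! ## §4 JOIN-C with the local inversion route, inverse laws on print's domains, WITNESS FORM -/

section JoinLocal

open B8Prop5JoinSectELocal (cond179_of_eq114')

variable {L k : ℕ} {η : ℝ} {Ω Λs : ℕ → Set (Site d)} {Eb : ℕ → Set (Site d × Fin d)} {U₀ : Site d → Fin d → 𝔸ˣ}
  {A : Site d → Fin d → 𝔸} {u₁ : Site d → 𝔸ˣ}

/-- **JOIN-C WITH THE LOCAL INVERSION ROUTE, [4]'s INVERSE LAWS ON PRINT'S DOMAINS, WITNESS FORM — PROPOSITION 5'S FIXED POINT FOR A GENERAL DATUM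
`u₁` READ THROUGH UNITARY `Λ_j`-WITNESSES.**  `B8Prop5JoinSectELocalRD.hFP_kLevel_of_sectE_local_RD` VERBATIM except: the Theorem-4 datum binders
`hBu h69 hP hAx hsmall hc₃ hsc` (small field `B`, `αP`, `α₃ = 40d·c_B`) ↦ the unitary `Λ_j`-witnesses `hwit` with a free class constant `α₃ ≤ 1/200`;
`D′(u₁⁻¹, −i·)` by `exists_Dprime_map_w`; the (1.29)-clause by `hFP_kLevel_of179_local_RD_w`.  As there: no `g_left`; `g_rightΩ` (right inverse
pointwise on `Ω₀`, [4] Thm 3.1; W8′) and `c_range` ((3.25); W8); `H_c λ := −i·H′D′(u₁⁻¹, −iλ)` (sizes `hE hE₂ lE lE₂`, reality by uniqueness,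
support by `H′`'s range); the only product window is r04's `2C₆(α₃ + 8α₄) < ½` (`hprod`).  DISPLAYED: the [4] letters `g Δ q qs Aw c` + `H′` with
laws∕bounds∕covariance (`hq`, `hH0`–`hH2`, `hHsupp`, `hHequiv`, `hQH`), [3]'s remainder covariance `hCequiv` (discharged in §5), the datum's
tower-local regime AT `u₁` ((1.33) `h33`, the witnesses `hwit`, (1.29) `Restr129 u₁`), tower bonds in `Eb j` (`hEbT`), (1.101)∕(1.98)R∕range∕
reality of `G′`, `R`, the source `A` (`hDA hDAsa hA hAsa`), JOIN-B's windows at the Sect. E sizes.  CONCLUSION: verbatim JOIN-B's (`λ′` Hermitian,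
`= 0` off `Ω₀`, (1.108), multiplier form on `Ω₀`, (1.29) for `u₁·e^{iλ′}`).
[cite: Balaban1985RegularSpaces, Prop. 5 (1.107)–(1.109) p.94, (1.92) p.91, (1.95)–(1.106) pp.92–94, (1.113)–(1.121) pp.95–97, (1.78)–(1.79)
p.90, (1.29) p.81, p.89; Balaban1985Averaging, Prop. 10 (203)–(204) p.50, (213)–(214) p.50] -/
theorem hFP_kLevel_of_sectE_local_RD_w (hL : 2 ≤ L) (hη : 0 < η) (hU₀ : ∀ x κ, U₀ x κ ∈ unitaryUnits 𝔸)
    (hEbΩ : ∀ j, j ≤ k → ∀ x ∈ Ω j, ∀ μ : Fin d, (x, μ) ∈ Eb j ∧ (x - e μ, μ) ∈ Eb j)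
    (hEbT : ∀ j, j ≤ k → ∀ y ∈ Λs j, ∀ (x : Site d) (κ : Fin d), InBox (tlo L y j) (thi L y j) x →
      InBox (tlo L y j) (thi L y j) (x + e κ) → (x, κ) ∈ Eb j)
    -- letters of [4]
    (g Δ : (Site d → 𝔸) →ₗ[ℂ] (Site d → 𝔸)) (q : (Site d → 𝔸) →ₗ[ℂ] (ℕ → Site d → 𝔸)) (qs : (ℕ → Site d → 𝔸) →ₗ[ℂ] (Site d → 𝔸))
    (Aw c : (ℕ → Site d → 𝔸) →ₗ[ℂ] (ℕ → Site d → 𝔸))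
    (g_rightΩ : ∀ x, ∀ y ∈ Ω 0, (Δ (g x) + qs (Aw (q (g x)))) y = x y)
    (c_range : ∀ f, q (g (g (qs (c (q f))))) = q f)
    (hΔ : ∀ (f : Site d → 𝔸), ∀ x ∈ Ω 0, Δ f x = covLap η U₀ ((Ω 0).indicator f) x)
    (hqs : ∀ (μ : ℕ → Site d → 𝔸), ∀ x ∈ Ω 0, qs μ x = QT L k Λs U₀ μ x)
    (hq : ∀ (f : Site d → 𝔸) (j : ℕ), j ≤ k → ∀ y ∈ Λs j, q f j y = QprimeIter (zdBlocking d L) (bgT L U₀) j f y)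
    -- the letter H′ of [4] ((1.92)) and the Sect. E / local-inversion regime (tower-local, everything AT u₁)
    (H' : XSpace d k 𝔸 →ₗ[ℂ] (Site d → 𝔸)) {α₀ α₃ α₄ B₀' B₂' : ℝ}
    (hα : 0 < α₀) (hα3 : C0 d * α₀ ≤ 1 / 3) (hα4 : 4 * α₀ ≤ c2' d L) (hα₃ : 0 ≤ α₃) (hα₄ : 0 < α₄) (hB : 0 < B₀') (hB₂ : 0 ≤ B₂')
    (h33 : ∀ j, j ≤ k → ∀ y ∈ Λs j, pdevOn (tlo L y j) (thi L y j) U₀ < α₀ * (((L : ℝ) ^ j)⁻¹) ^ 2)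
    (hwit : ∀ j, j ≤ k → ∀ y ∈ Λs j, ∃ ut : Site d → 𝔸ˣ, (∀ x, ut x ∈ unitaryUnits 𝔸) ∧
      InLambda L (clampCfg (tlo L y j) (thi L y j) U₀) ut j α₃ (((L : ℝ) ^ j)⁻¹) ∧
      ∀ x : Site d, tlo L y j ≤ x → x ≤ thi L y j → u₁ x = ut x)
    (h129 : Restr129 L k Λs U₀ u₁)
    (hH0 : ∀ (X : XSpace d k 𝔸) (x : Site d), ‖H' X x‖ ≤ B₀' * ‖X‖)
    (hH1 : ∀ j, j ≤ k → ∀ (X : XSpace d k 𝔸), ∀ p ∈ Eb j, wt L η j * ‖covDerivFwd η U₀ p.2 (H' X) p.1‖ ≤ B₀' * ‖X‖)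
    (hH2 : ∀ X : XSpace d k 𝔸, Bd2 L η k Ω (covLap η U₀ (H' X)) (B₂' * ‖X‖))
    (hHsupp : ∀ (X : XSpace d k 𝔸) (x : Site d), x ∉ Ω 0 → H' X x = 0)
    (hHequiv : ∀ X Y : XSpace d k 𝔸, (∀ p, Y p = -star (X p)) → ∀ x, H' Y x = -star (H' X x))
    (hQH : ∀ (Y : XSpace d k 𝔸) (j : ℕ) (hj : j ≤ k) (y : Site d), y ∈ Λs j →
      QprimeIter (zdBlocking d L) (bgT L U₀) j (H' Y) y = Y (⟨j, Nat.lt_succ_of_le hj⟩, y))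
    (hCequiv : ∀ j, j ≤ k → ∀ y ∈ Λs j, ∀ μ : Site d → 𝔸,
      (∀ x : Site d, InBox (tlo L y j) (thi L y j) x → ‖μ x‖ < α₄) →
      (∀ (x : Site d) (κ : Fin d), InBox (tlo L y j) (thi L y j) x → InBox (tlo L y j) (thi L y j) (x + e κ) →
        ‖cj (U₀ x κ) (μ (x + e κ)) - μ x‖ < α₄ * ((L : ℝ) ^ j)⁻¹) →
      Cnl L U₀ u₁⁻¹ j (fun x => -star (μ x)) y = -star (Cnl L U₀ u₁⁻¹ j μ y))
    (hα₃' : α₃ ≤ 1 / 200)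
    (hs₁ : 200 * C6 d * (2 * α₄) ≤ 1) (hs₂ : 12000 * ((d : ℝ) + 1) * L * (2 * α₄) ≤ 1)
    (hs₃ : C4G d L * (α₀ + α₃ + 4 * (2 * α₄)) ≤ 1)
    (hs₄ : 1024 * ((d : ℝ) + 1) * ((d : ℝ) + 4) * L ^ 2 * α₀ ≤ 1) (hs₅ : 32 * ((d : ℝ) + 1) ^ 2 * C6 d * L ^ 2 * α₀ ≤ 1)
    (hs₆ : 16 * d * C5' d * C6 d * (L : ℝ) ^ 2 * α₀ ≤ 1) (hs₇ : 8 * d * C6 d * L * α₀ ≤ 1)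
    (hsm : α₃ + α₄ ≤ 1 / (4 * B₀' * (2 * C2p d))) (hprod : 2 * C6 d * (α₃ + 4 * (2 * α₄)) < 1 / 2)
    -- the Sect. E sizes of H_c (named, so that the windows below read)
    {hE hE₂ lE lE₂ : ℝ} (hE_def : hE = B₀' * (C2p d * (α₃ + α₄) * α₄)) (hE₂_def : hE₂ = B₂' * (C2p d * (α₃ + α₄) * α₄))
    (lE_def : lE = B₀' * (4 * C2p d * (α₃ + 2 * α₄))) (lE₂_def : lE₂ = B₂' * (4 * C2p d * (α₃ + 2 * α₄)))
    -- JOIN-B's letters G′, R, the datum, and its windows at these sizes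
    {BG BR cA cDA : ℝ} (hBG : 0 ≤ BG) (hBR : 0 ≤ BR) (hcA : 0 ≤ cA) (hcA' : cA ≤ 1 / 13) (hcDA : 0 ≤ cDA)
    (ha₁' : α₄ / 4 + hE ≤ 1 / 24) (hb₁' : α₄ / 4 + hE ≤ 1 / 140) (hθ : 10 * (α₄ / 4 + hE) * BR ≤ 1 / 2)
    (hG : ∀ (f : Site d → 𝔸) (m : ℝ), 0 ≤ m → Bd2 L η k Ω f m →
      (∀ x, ‖g f x‖ ≤ BG * m) ∧ ∀ j, j ≤ k → ∀ p ∈ Eb j, wt L η j * ‖covDerivFwd η U₀ p.2 (g f) p.1‖ ≤ BG * m)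
    (hGsupp : ∀ (f : Site d → 𝔸) (x : Site d), x ∉ Ω 0 → g f x = 0)
    (hGreal : ∀ f : Site d → 𝔸, (∀ j, j ≤ k → ∀ x ∈ Ω j, IsSelfAdjoint (f x)) → ∀ x, IsSelfAdjoint (g f x))
    (hRbd : ∀ (f : Site d → 𝔸) (m : ℝ), 0 ≤ m → Bd2 L η k Ω f m → Bd2 L η k Ω (f - g (qs (c (q (g f))))) (BR * m))
    (hRreal : ∀ f : Site d → 𝔸, (∀ j, j ≤ k → ∀ x ∈ Ω j, IsSelfAdjoint (f x)) →
      ∀ j, j ≤ k → ∀ x ∈ Ω j, IsSelfAdjoint ((f - g (qs (c (q (g f))))) x))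
    (hDA : Bd2 L η k Ω (fun y => covDivB η U₀ A y) cDA) (hDAsa : ∀ j, j ≤ k → ∀ x ∈ Ω j, IsSelfAdjoint (covDivB η U₀ A x))
    (hA : ∀ j, j ≤ k → ∀ x ∈ Ω j, ∀ μ : Fin d,
      wt L η j * ‖A x μ‖ ≤ cA ∧ wt L η j * ‖conjR (U₀ (x - e μ) μ)⁻¹ (A (x - e μ) μ)‖ ≤ cA)
    (hAsa : ∀ x μ, IsSelfAdjoint (A x μ))
    (h103 : BG * Mc d BR (α₄ / 4 + hE) cA hE₂ cDA ≤ α₄ / 4)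
    (h106 : BG * Kc d BR (α₄ / 4 + hE) cA hE₂ cDA lE₂ (1 + lE) (1 + lE) ≤ 1 / 2) :
    ∃ lam : Site d → 𝔸, (∀ x, IsSelfAdjoint (lam x)) ∧ (∀ x, x ∉ Ω 0 → lam x = 0) ∧
      (∀ j, j ≤ k → ∀ p ∈ Eb j, ‖lam p.1‖ ≤ α₄ ∧ wt L η j * ‖covDerivFwd η U₀ p.2 lam p.1‖ ≤ α₄) ∧
      (∃ μ : ℕ → Site d → 𝔸, ∀ x ∈ Ω 0,
        covLap η U₀ ((Ω 0).indicator fun y => covDivB η U₀ A y + covLap η U₀ lam y +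
          ((conjR (gaugeExp lam y)⁻¹ (covDivB η U₀ A y) - covDivB η U₀ A y) +
            (gAd (covLap η U₀ lam y) (lam y) - covLap η U₀ lam y) + ∑ μ, frakF3 η U₀ lam A y μ)) x = QT L k Λs U₀ μ x) ∧
      Restr129 L k Λs U₀ (u₁ * gaugeExp lam) := by
  have hL1 : 1 ≤ L := le_trans (by norm_num) hL
  have hC2 : 0 ≤ C2p d := C2p_nonneg d
  have hC2pos : 0 < C2p d := by
    have hC6 : (2 : ℝ) ≤ C6 d := by unfold C6; linarith [one_le_C5 (d := d)]
    unfold C2p Cgen; positivity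
  have hhE : 0 ≤ hE := by rw [hE_def]; positivity
  have hhE₂ : 0 ≤ hE₂ := by rw [hE₂_def]; positivity
  have hlE : 0 ≤ lE := by rw [lE_def]; positivity
  have hlE₂ : 0 ≤ lE₂ := by rw [lE₂_def]; positivity
  have hb₁ : 0 < α₄ / 4 + hE := add_pos_of_pos_of_nonneg (by positivity) hhE
  -- `h₀ ≤ ¾α₄` from print's smallness in product form
  have hh₀' : hE ≤ 3 * α₄ / 4 := by
    have h8 := (B8SectEKLevelInLambda.smallness_prod_w (d := d) hα₃ hB hC2pos hsm).1
    have e1 : hE = (C2p d * (α₃ + α₄) * B₀') * α₄ := by rw [hE_def]; ring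
    rw [e1]
    calc C2p d * (α₃ + α₄) * B₀' * α₄ ≤ 1 / 8 * α₄ := mul_le_mul_of_nonneg_right h8 hα₄.le
      _ ≤ 3 * α₄ / 4 := by linarith only [hα₄]
  -- THE solution map D′(u₁⁻¹, −i·) on the ¼α₄-ball (chosen once; Lipschitz; real on Hermitian λ)
  obtain ⟨Dp, hDp, hDpL, hDpR⟩ := exists_Dprime_map_w hL hη hU₀ H' hα hα3 hα4 hα₃ hα₄ hB h33 hwit hEbT hH0 hH1 hHequiv hQH hCequiv hα₃' hs₁ hs₂
    hs₃ hs₄ hs₅ hs₆ hs₇ hsm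
  -- sizes of D′ and of its differences, multiplied by the (1.92) constants
  have hbdX : ∀ s : lamSubK η U₀ L k Eb, ‖s‖ ≤ α₄ / 4 → B₀' * ‖Dp (lamOf s)‖ ≤ hE := fun s hs => by
    rw [hE_def]; exact mul_le_mul_of_nonneg_left (hDp s hs).2.1 hB.le
  have hbdX₂ : ∀ s : lamSubK η U₀ L k Eb, ‖s‖ ≤ α₄ / 4 → B₂' * ‖Dp (lamOf s)‖ ≤ hE₂ := fun s hs => by
    rw [hE₂_def]; exact mul_le_mul_of_nonneg_left (hDp s hs).2.1 hB₂
  have hbdL : ∀ s t : lamSubK η U₀ L k Eb, ‖s‖ ≤ α₄ / 4 → ‖t‖ ≤ α₄ / 4 → B₀' * ‖Dp (lamOf s) - Dp (lamOf t)‖ ≤ lE * ‖s - t‖ :=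
    fun s t hs ht => by
    rw [lE_def, mul_assoc]; exact mul_le_mul_of_nonneg_left (hDpL s t hs ht) hB.le
  have hbdL₂ : ∀ s t : lamSubK η U₀ L k Eb, ‖s‖ ≤ α₄ / 4 → ‖t‖ ≤ α₄ / 4 → B₂' * ‖Dp (lamOf s) - Dp (lamOf t)‖ ≤ lE₂ * ‖s - t‖ :=
    fun s t hs ht => by
    rw [lE₂_def, mul_assoc]; exact mul_le_mul_of_nonneg_left (hDpL s t hs ht) hB₂
  have hsubH : ∀ s t : lamSubK η U₀ L k Eb, (-I) • H' (Dp (lamOf s)) - (-I) • H' (Dp (lamOf t)) = (-I) • H' (Dp (lamOf s) - Dp (lamOf t)) :=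
    fun s t => by rw [map_sub, smul_sub]
  -- the eight binders of JOIN-B for `H_c λ := −i·H′D′(u₁⁻¹, −iλ)`
  have hc0 : ∀ s : lamSubK η U₀ L k Eb, ‖s‖ ≤ α₄ / 4 → ∀ x, ‖((-I) • H' (Dp (lamOf s))) x‖ ≤ hE := fun s hs x => by
    rw [Pi.smul_apply, norm_negI_smul]; exact (hH0 _ x).trans (hbdX s hs)
  have hc1 : ∀ s : lamSubK η U₀ L k Eb, ‖s‖ ≤ α₄ / 4 → ∀ j, j ≤ k → ∀ p ∈ Eb j,
      wt L η j * ‖covDerivFwd η U₀ p.2 ((-I) • H' (Dp (lamOf s))) p.1‖ ≤ hE := fun s hs j hj p hp => by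
    rw [covDerivFwd_smul, norm_negI_smul]; exact (hH1 j hj _ p hp).trans (hbdX s hs)
  have hc2 : ∀ s : lamSubK η U₀ L k Eb, ‖s‖ ≤ α₄ / 4 → Bd2 L η k Ω (covLap η U₀ ((-I) • H' (Dp (lamOf s)))) hE₂ :=
    fun s hs j hj x hx => by
    rw [covLap_smul, norm_negI_smul]; exact (hH2 _ j hj x hx).trans (hbdX₂ s hs)
  have hcL0 : ∀ s t : lamSubK η U₀ L k Eb, ‖s‖ ≤ α₄ / 4 → ‖t‖ ≤ α₄ / 4 → ∀ x,
      ‖((-I) • H' (Dp (lamOf s))) x - ((-I) • H' (Dp (lamOf t))) x‖ ≤ lE * ‖s - t‖ := fun s t hs ht x => by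
    rw [← Pi.sub_apply, hsubH, Pi.smul_apply, norm_negI_smul]; exact (hH0 _ x).trans (hbdL s t hs ht)
  have hcL1 : ∀ s t : lamSubK η U₀ L k Eb, ‖s‖ ≤ α₄ / 4 → ‖t‖ ≤ α₄ / 4 → ∀ j, j ≤ k → ∀ p ∈ Eb j,
      wt L η j * ‖covDerivFwd η U₀ p.2 ((-I) • H' (Dp (lamOf s)) - (-I) • H' (Dp (lamOf t))) p.1‖ ≤ lE * ‖s - t‖ :=
    fun s t hs ht j hj p hp => by
    rw [hsubH, covDerivFwd_smul, norm_negI_smul]; exact (hH1 j hj _ p hp).trans (hbdL s t hs ht)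
  have hcL2 : ∀ s t : lamSubK η U₀ L k Eb, ‖s‖ ≤ α₄ / 4 → ‖t‖ ≤ α₄ / 4 →
      Bd2 L η k Ω (covLap η U₀ ((-I) • H' (Dp (lamOf s))) - covLap η U₀ ((-I) • H' (Dp (lamOf t)))) (lE₂ * ‖s - t‖) :=
    fun s t hs ht j hj x hx => by
    rw [Pi.sub_apply, ← covLap_sub, hsubH, covLap_smul, norm_negI_smul]; exact (hH2 _ j hj x hx).trans (hbdL₂ s t hs ht)
  have hcsa : ∀ s : lamSubK η U₀ L k Eb, ‖s‖ ≤ α₄ / 4 → (∀ x, IsSelfAdjoint (lamOf s x)) →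
      ∀ x, IsSelfAdjoint (((-I) • H' (Dp (lamOf s))) x) := fun s hs hsa x => by
    rw [Pi.smul_apply]
    refine isSelfAdjoint_negI_smul_of_skew ?_
    have hX : ∀ p, Dp (lamOf s) p = -star (Dp (lamOf s) p) := fun p => by rw [hDpR s hs hsa p, neg_neg]
    have h2 := congrArg star (hHequiv (Dp (lamOf s)) (Dp (lamOf s)) hX x)
    rw [star_neg, star_star] at h2
    exact h2
  have hcsupp : ∀ s : lamSubK η U₀ L k Eb, ‖s‖ ≤ α₄ / 4 → ∀ x, x ∉ Ω 0 → ((-I) • H' (Dp (lamOf s))) x = 0 := fun s _ x hx => by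
    rw [Pi.smul_apply, hHsupp _ x hx, smul_zero]
  -- «Q′(u₁⁻¹, e^{−iλ′}) = 0 on 𝔅_k» from (1.114), in the shape of the local route
  have h179E : ∀ s : lamSubK η U₀ L k Eb, ‖s‖ ≤ α₄ / 4 → q (lamOf s) = 0 →
      Cond179 L k Λs U₀ (fun x => expUnit (((-I) • (lamOf s + (-I) • H' (Dp (lamOf s)))) x)) u₁⁻¹ := fun s hs hq0 =>
    cond179_of_eq114' H' q hq s (hDp s hs).2.2.2.2 hq0
  -- r04's Prop-10 windows at 8α₄ from the Sect. E windows at 2α₄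
  have hC6 : (0 : ℝ) ≤ C6 d := by
    have : (2 : ℝ) ≤ C6 d := by unfold C6; linarith only [one_le_C5 (d := d)]
    linarith only [this]
  have hw₁ : 10 * C6 d * (4 * (2 * α₄)) ≤ 1 := by nlinarith only [hs₁, hC6, hα₄.le]
  have hw₂ : 3000 * ((d : ℝ) + 1) * L * (4 * (2 * α₄)) ≤ 1 := by
    have e : 3000 * ((d : ℝ) + 1) * L * (4 * (2 * α₄)) = 12000 * ((d : ℝ) + 1) * L * (2 * α₄) := by ring
    rw [e]; exact hs₂
  exact hFP_kLevel_of179_local_RD_w hL hη hU₀ hEbΩ hEbT g Δ q qs Aw c g_rightΩ c_range hΔ hqs (fun lam => (-I) • H' (Dp lam)) hα hα3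
    hα4 hα₃ h33 hwit h129 hα₃' hw₁ hw₂ hs₃ hs₄ hs₅ hs₆ hprod hα₄ hBG hBR hhE hhE₂ hlE hlE hlE₂ hcA hcA' hcDA ha₁' hb₁' hb₁ hθ hh₀' hh₀' hG
    hGsupp hGreal hRbd hRreal hc0 hc1 hc2 hcL0 hcL1 hcL2 hcsa hcsupp hDA hDAsa hA hAsa h103 h106 h179E



end JoinLocal

/-! ## §5 `hCequiv` DISCHARGED, inverse laws on print's domains, WITNESS FORM — the theorem a general-datum Prop.-5 provider instantiates -/

section JoinLocalReal

variable {L k : ℕ} {η : ℝ} {Ω Λs : ℕ → Set (Site d)} {Eb : ℕ → Set (Site d × Fin d)} {U₀ : Site d → Fin d → 𝔸ˣ}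
  {A : Site d → Fin d → 𝔸} {u₁ : Site d → 𝔸ˣ}

/-- **JOIN-C, LOCAL ROUTE, WITH [3]'S REMAINDER COVARIANCE DISCHARGED, [4]'s INVERSE LAWS ON PRINT'S DOMAINS, WITNESS FORM** — the theorem a
Proposition-5 provider AT A GENERAL DATUM instantiates (`B8Prop5JoinSectELocalRD.hFP_kLevel_of_sectE_local'_RD` with the Theorem-4 datum binders
`hBu h69 hP hAx hsmall hc₃ hsc` ↦ `hwit` + free `α₃ ≤ 1/200`; `hCequiv` PROVED by `Cnl_negStar_inv_of_hwit`, i.e. `pub-ymgap-dag-n04-b`'s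
`B8SectERemainderCovariance.Cnl_negStar_of_witness` at the unitary witness `ũ⁻¹`).  As there: no `g_left`; `g_rightΩ` and `c_range` in place of the
total laws; the two product windows merged into ONE: `2C₆(α₃ + 4α₄) ≤ ⅛` (`hprod8`; it gives r04's `4C₆α₄ ≤ ⅛` and the local route's
`2C₆(α₃ + 8α₄) < ½`).  After this the only displayed LAWS are those of [4]'s letters (`g Δ q qs Aw c`, `H′`: readings, (1.91)–(1.92),
(1.98)–(1.101), range, reality, `hHequiv`); the datum enters through (1.33) `h33`, the unitary `Λ_j`-witnesses `hwit` (print: (1.68), (1.73), (1.74)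
via `B8Prop5WitnessOfDatum.hwit_unitary_of_datum`; Theorem 4: `witness_unitary_of_glev ∘ glev_on_towers_of_axial`), (1.29) `Restr129 u₁`, and the
source bounds `hDA hDAsa hA hAsa` on `A`; tower bonds in `Eb j`, `G′`∕`R` binders, windows.  CONCLUSION: JOIN-B's.
[cite: Balaban1985RegularSpaces, Prop. 5 (1.107)–(1.109) p.94, (1.113)–(1.121) pp.95–97, p.93, p.89, (1.29) p.81; Balaban1985Averaging, (22)–(23) p.21,
(78)–(80) p.30, (178) p.45, Prop. 10 (203)–(204) p.50, (213)–(214) p.50] -/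
theorem hFP_kLevel_of_sectE_local'_RD_w (hL : 2 ≤ L) (hη : 0 < η) (hU₀ : ∀ x κ, U₀ x κ ∈ unitaryUnits 𝔸)
    (hEbΩ : ∀ j, j ≤ k → ∀ x ∈ Ω j, ∀ μ : Fin d, (x, μ) ∈ Eb j ∧ (x - e μ, μ) ∈ Eb j)
    (hEbT : ∀ j, j ≤ k → ∀ y ∈ Λs j, ∀ (x : Site d) (κ : Fin d), InBox (tlo L y j) (thi L y j) x →
      InBox (tlo L y j) (thi L y j) (x + e κ) → (x, κ) ∈ Eb j)
    -- letters of [4]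
    (g Δ : (Site d → 𝔸) →ₗ[ℂ] (Site d → 𝔸)) (q : (Site d → 𝔸) →ₗ[ℂ] (ℕ → Site d → 𝔸)) (qs : (ℕ → Site d → 𝔸) →ₗ[ℂ] (Site d → 𝔸))
    (Aw c : (ℕ → Site d → 𝔸) →ₗ[ℂ] (ℕ → Site d → 𝔸))
    (g_rightΩ : ∀ x, ∀ y ∈ Ω 0, (Δ (g x) + qs (Aw (q (g x)))) y = x y)
    (c_range : ∀ f, q (g (g (qs (c (q f))))) = q f)
    (hΔ : ∀ (f : Site d → 𝔸), ∀ x ∈ Ω 0, Δ f x = covLap η U₀ ((Ω 0).indicator f) x)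
    (hqs : ∀ (μ : ℕ → Site d → 𝔸), ∀ x ∈ Ω 0, qs μ x = QT L k Λs U₀ μ x)
    (hq : ∀ (f : Site d → 𝔸) (j : ℕ), j ≤ k → ∀ y ∈ Λs j, q f j y = QprimeIter (zdBlocking d L) (bgT L U₀) j f y)
    -- the letter H′ of [4] ((1.92)) and the Sect. E / local-inversion / covariance regime (tower-local, everything AT u₁)
    (H' : XSpace d k 𝔸 →ₗ[ℂ] (Site d → 𝔸)) {α₀ α₃ α₄ B₀' B₂' : ℝ}
    (hα : 0 < α₀) (hα3 : C0 d * α₀ ≤ 1 / 3) (hα4 : 4 * α₀ ≤ c2' d L) (hα₃ : 0 ≤ α₃) (hα₄ : 0 < α₄) (hB : 0 < B₀') (hB₂ : 0 ≤ B₂')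
    (h33 : ∀ j, j ≤ k → ∀ y ∈ Λs j, pdevOn (tlo L y j) (thi L y j) U₀ < α₀ * (((L : ℝ) ^ j)⁻¹) ^ 2)
    (hwit : ∀ j, j ≤ k → ∀ y ∈ Λs j, ∃ ut : Site d → 𝔸ˣ, (∀ x, ut x ∈ unitaryUnits 𝔸) ∧
      InLambda L (clampCfg (tlo L y j) (thi L y j) U₀) ut j α₃ (((L : ℝ) ^ j)⁻¹) ∧
      ∀ x : Site d, tlo L y j ≤ x → x ≤ thi L y j → u₁ x = ut x)
    (h129 : Restr129 L k Λs U₀ u₁)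
    (hH0 : ∀ (X : XSpace d k 𝔸) (x : Site d), ‖H' X x‖ ≤ B₀' * ‖X‖)
    (hH1 : ∀ j, j ≤ k → ∀ (X : XSpace d k 𝔸), ∀ p ∈ Eb j, wt L η j * ‖covDerivFwd η U₀ p.2 (H' X) p.1‖ ≤ B₀' * ‖X‖)
    (hH2 : ∀ X : XSpace d k 𝔸, Bd2 L η k Ω (covLap η U₀ (H' X)) (B₂' * ‖X‖))
    (hHsupp : ∀ (X : XSpace d k 𝔸) (x : Site d), x ∉ Ω 0 → H' X x = 0)
    (hHequiv : ∀ X Y : XSpace d k 𝔸, (∀ p, Y p = -star (X p)) → ∀ x, H' Y x = -star (H' X x))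
    (hQH : ∀ (Y : XSpace d k 𝔸) (j : ℕ) (hj : j ≤ k) (y : Site d), y ∈ Λs j →
      QprimeIter (zdBlocking d L) (bgT L U₀) j (H' Y) y = Y (⟨j, Nat.lt_succ_of_le hj⟩, y))
    (hα₃' : α₃ ≤ 1 / 200)
    (hs₁ : 200 * C6 d * (2 * α₄) ≤ 1) (hs₂ : 12000 * ((d : ℝ) + 1) * L * (2 * α₄) ≤ 1)
    (hs₃ : C4G d L * (α₀ + α₃ + 4 * (2 * α₄)) ≤ 1)
    (hs₄ : 1024 * ((d : ℝ) + 1) * ((d : ℝ) + 4) * L ^ 2 * α₀ ≤ 1) (hs₅ : 32 * ((d : ℝ) + 1) ^ 2 * C6 d * L ^ 2 * α₀ ≤ 1)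
    (hs₆ : 16 * d * C5' d * C6 d * (L : ℝ) ^ 2 * α₀ ≤ 1) (hs₇ : 8 * d * C6 d * L * α₀ ≤ 1)
    (hsm : α₃ + α₄ ≤ 1 / (4 * B₀' * (2 * C2p d))) (hprod8 : 2 * C6 d * (α₃ + 4 * α₄) ≤ 1 / 8)
    -- the Sect. E sizes of H_c (named, so that the windows below read)
    {hE hE₂ lE lE₂ : ℝ} (hE_def : hE = B₀' * (C2p d * (α₃ + α₄) * α₄)) (hE₂_def : hE₂ = B₂' * (C2p d * (α₃ + α₄) * α₄))
    (lE_def : lE = B₀' * (4 * C2p d * (α₃ + 2 * α₄))) (lE₂_def : lE₂ = B₂' * (4 * C2p d * (α₃ + 2 * α₄)))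
    -- JOIN-B's letters G′, R, the datum, and its windows at these sizes
    {BG BR cA cDA : ℝ} (hBG : 0 ≤ BG) (hBR : 0 ≤ BR) (hcA : 0 ≤ cA) (hcA' : cA ≤ 1 / 13) (hcDA : 0 ≤ cDA)
    (ha₁' : α₄ / 4 + hE ≤ 1 / 24) (hb₁' : α₄ / 4 + hE ≤ 1 / 140) (hθ : 10 * (α₄ / 4 + hE) * BR ≤ 1 / 2)
    (hG : ∀ (f : Site d → 𝔸) (m : ℝ), 0 ≤ m → Bd2 L η k Ω f m →
      (∀ x, ‖g f x‖ ≤ BG * m) ∧ ∀ j, j ≤ k → ∀ p ∈ Eb j, wt L η j * ‖covDerivFwd η U₀ p.2 (g f) p.1‖ ≤ BG * m)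
    (hGsupp : ∀ (f : Site d → 𝔸) (x : Site d), x ∉ Ω 0 → g f x = 0)
    (hGreal : ∀ f : Site d → 𝔸, (∀ j, j ≤ k → ∀ x ∈ Ω j, IsSelfAdjoint (f x)) → ∀ x, IsSelfAdjoint (g f x))
    (hRbd : ∀ (f : Site d → 𝔸) (m : ℝ), 0 ≤ m → Bd2 L η k Ω f m → Bd2 L η k Ω (f - g (qs (c (q (g f))))) (BR * m))
    (hRreal : ∀ f : Site d → 𝔸, (∀ j, j ≤ k → ∀ x ∈ Ω j, IsSelfAdjoint (f x)) →
      ∀ j, j ≤ k → ∀ x ∈ Ω j, IsSelfAdjoint ((f - g (qs (c (q (g f))))) x))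
    (hDA : Bd2 L η k Ω (fun y => covDivB η U₀ A y) cDA) (hDAsa : ∀ j, j ≤ k → ∀ x ∈ Ω j, IsSelfAdjoint (covDivB η U₀ A x))
    (hA : ∀ j, j ≤ k → ∀ x ∈ Ω j, ∀ μ : Fin d,
      wt L η j * ‖A x μ‖ ≤ cA ∧ wt L η j * ‖conjR (U₀ (x - e μ) μ)⁻¹ (A (x - e μ) μ)‖ ≤ cA)
    (hAsa : ∀ x μ, IsSelfAdjoint (A x μ))
    (h103 : BG * Mc d BR (α₄ / 4 + hE) cA hE₂ cDA ≤ α₄ / 4)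
    (h106 : BG * Kc d BR (α₄ / 4 + hE) cA hE₂ cDA lE₂ (1 + lE) (1 + lE) ≤ 1 / 2) :
    ∃ lam : Site d → 𝔸, (∀ x, IsSelfAdjoint (lam x)) ∧ (∀ x, x ∉ Ω 0 → lam x = 0) ∧
      (∀ j, j ≤ k → ∀ p ∈ Eb j, ‖lam p.1‖ ≤ α₄ ∧ wt L η j * ‖covDerivFwd η U₀ p.2 lam p.1‖ ≤ α₄) ∧
      (∃ μ : ℕ → Site d → 𝔸, ∀ x ∈ Ω 0,
        covLap η U₀ ((Ω 0).indicator fun y => covDivB η U₀ A y + covLap η U₀ lam y +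
          ((conjR (gaugeExp lam y)⁻¹ (covDivB η U₀ A y) - covDivB η U₀ A y) +
            (gAd (covLap η U₀ lam y) (lam y) - covLap η U₀ lam y) + ∑ μ, frakF3 η U₀ lam A y μ)) x = QT L k Λs U₀ μ x) ∧
      Restr129 L k Λs U₀ (u₁ * gaugeExp lam) := by
  have hC6 : (0 : ℝ) ≤ C6 d := by
    have : (2 : ℝ) ≤ C6 d := by unfold C6; linarith only [one_le_C5 (d := d)]
    linarith only [this]
  have hC4G : 0 ≤ C4G d L := by
    have h7 : (0 : ℝ) ≤ B7Prop10General.C7 d := by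
      unfold B7Prop10General.C7 C6; linarith only [one_le_C5 (d := d), C5'_nonneg (d := d)]
    have h4' := C4'_nonneg (d := d)
    unfold C4G; positivity
  -- the local route's product window and (D)'s windows at 4α₄ from the Sect. E windows at 2α₄ and `hprod8`
  have hprod : 2 * C6 d * (α₃ + 4 * (2 * α₄)) < 1 / 2 := by nlinarith only [hprod8, hC6, hα₃, hα₄.le]
  have h204w : C6 d * (4 * α₄) ≤ 1 / 8 := by nlinarith only [hprod8, hC6, hα₃, hα₄.le]
  have hd₁ : 10 * C6 d * (4 * α₄) ≤ 1 := by nlinarith only [hs₁, hC6, hα₄.le]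
  have hd₂ : 3000 * ((d : ℝ) + 1) * L * (4 * α₄) ≤ 1 := by
    have e : 3000 * ((d : ℝ) + 1) * L * (4 * α₄) = 12000 * ((d : ℝ) + 1) * L * (2 * α₄) / 2 := by ring
    rw [e]; linarith only [hs₂, show (0:ℝ) ≤ 12000 * ((d : ℝ) + 1) * L * (2 * α₄) by positivity]
  have hd₃ : C4G d L * (α₀ + α₃ + 4 * α₄) ≤ 1 :=
    (mul_le_mul_of_nonneg_left (by linarith only [hα₄]) hC4G).trans hs₃
  have hCequiv := Cnl_negStar_inv_of_hwit Λs hL (le_trans (by norm_num) hL) hU₀ hα hα3 hα4 hα₃ hα₄ h33 hwit (by linarith only [hα₃'])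
    hd₁ hd₂ hd₃ hs₄ hs₅ hs₆ hprod8 h204w
  exact hFP_kLevel_of_sectE_local_RD_w hL hη hU₀ hEbΩ hEbT g Δ q qs Aw c g_rightΩ c_range hΔ hqs hq H' hα hα3 hα4 hα₃ hα₄ hB hB₂ h33
    hwit h129 hH0 hH1 hH2 hHsupp hHequiv hQH hCequiv hα₃' hs₁ hs₂ hs₃ hs₄ hs₅ hs₆ hs₇ hsm hprod hE_def hE₂_def lE_def lE₂_def hBG hBR hcA
    hcA' hcDA ha₁' hb₁' hθ hG hGsupp hGreal hRbd hRreal hDA hDAsa hA hAsa h103 h106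



end JoinLocalReal

end Literature.MathematicalPhysics.QuantumFieldTheory.Balaban1983to89.B8Prop5JoinSectELocalRDW

end
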